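import Literature.NumberTheory.Sieve.HeathBrownCubicFLRemaindersA
import Literature.NumberTheory.Sieve.HeathBrownCubicFLSequencesB
import Literature.NumberTheory.Sieve.HeathBrownCubicFLChains
import Literature.NumberTheory.Sieve.HeathBrownCubicFLProducts
import HarnessLib

/-!
# Heath-Brown's Lemma 3.5, VI: assembly of the Fundamental-Lemma comparison (§6)

Sixth and final file of the proof of the named fact `HeathBrown2001_lemma_3_5`
(`HeathBrownCubicSieveDecomposition`; D. R. Heath-Brown, *Primes represented by `x³ + 2y³`*, Acta
Math. 186 (2001), 1–84, Lemma 3.5, proved in §6, pp. 34–39): for `0 < ϖ < 1/5`, `τ = (log log X)^{-ϖ}`,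
`exp(−(log X)^{1/3}) ≤ η ≤ 1`,
`∑_{n ≤ n₀} |T^(n)(𝒜) − κT^(n)(ℬ)| ≪ τη²X²/log X`.

**Main results.** `HeathBrown2001_lemma_3_5_of hlev hmer : HeathBrown2001_lemma_3_5`, where
* `hlev` is the level-of-distribution input for `𝒜` in the summed form that Lemma 3.2 yields
  (`HeathBrownCubicFLRemaindersA.level_of_typeI_A`): for some `θ < 2`,
  `∑_{N(R) ≤ X^{3/2}, N(R) square-free} |#𝒜^(K)_R − (6η²X²/π²)ρ₂(R)/N(R)| ≤ CX^θ`; hence also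
  `HeathBrown2001_lemma_3_5_of_typeI_A : HeathBrown2001_typeI_A → (Mertens-K) → HeathBrown2001_lemma_3_5`;
* `hmer` is Mertens' theorem for the prime ideals of `K = ℚ(∛2)` with the residue constant `γ₀`,
  grouped by rational primes: `∏_{p<z}∏_{P∣p}(1 − N(P)^{-1})·e^γγ₀log z = 1 + O(1/log z)`
  (Rosen 1999, Thm 2; the source of (6.9)). It is an explicit hypothesis here, to be proved separately;
  no named fact is introduced in this file.

**The proof** is §6 of the paper, organised as follows (level `D = X^{1/4}` on both sides, `z = X^τ`,
`s = log D/log z = 1/(4τ)`; the paper takes `D = X^{1−τ}`, any `s → ∞` with `e^{-s} = o(τ²/…)` works):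
* `𝒜`-side (pp. 34–35): `T^(n)(𝒜) = ∑_{t} S(𝒜_{∏t}, z)` exactly ((6.1), `Tpiece_boxPairs_eq`); the tree's
  two-sided Fundamental Lemma (`SieveSequence.fundamental_lemma_uniform_holds`, `Ω(3)` by
  `hasSieveDimension_densA`) gives `abs_TpieceA_sub_le`; the remainders `R_d(𝒜_q)` are sums over the
  ideals of norm `qd` (`abs_remainder_seqA_le`), the moduli `qd ≤ X^{1+τ}D ≤ X^{3/2}` being DISTINCT
  square-free numbers (`sum_remaindersA_le`: `d = (qd, P(z))`, `t` = prime factors of `q`), so their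
  total is bounded by the level of distribution `hlev`.
* `ℬ`-side (pp. 35–37): `T^(n)(ℬ) = ∑_s #{J' : 3X³/N(∏s) < N(J') ≤ (1+η)3X³/N(∏s), J' z-rough}` exactly
  (`TpieceB_eq`, from `famSifted_normWindow_eq`); up to the degree-`≥ 2` discrepancy
  (`card_isRough_sub_sifted_mem_Icc`, `≤ C_ℬX³N(∏s)^{-1}·9z^{-1/2}` by `sum_inv_absNorm_primesAbove_large_le`)
  this is the window sequence of `HeathBrownCubicNormWindowSieve` sifted by the primes `< z`, to which
  the Fundamental Lemma applies (`Ω(3)`: `hasSieveDimension_normDensity`; remainders: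
  `sum_abs_remainder_windowSeq_le`), giving `abs_roughWindow_sub_le`, `abs_TpieceB_sub_le`.
* Main terms (pp. 37–39): `M_𝒜(n) − κM_ℬ(n) = η²X²{[(6/π²)V_𝒜 − σ₀V]Σ₀ + σ₀[V − γ₀V_ℬ]Σ₁ + σ₀V[Σ₀ − Σ₁]}`
  (`mainTerms_eq`), estimated by (6.7) (`exists_abs_prodA_sub_le`), (6.9) (`exists_abs_prodB_sub_le_of`,
  from `hmer`) and the chain-sum comparison `sum_abs_chainSumA_sub_chainSumB_le`; totals over `n` by
  `∑Σ₀, ∑Σ₁ ≤ e^{W₁} ≤ e³/τ` (`exists_smallPrimesWeight_le`).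
* `sum_abs_Tpiece_sub_le_explicit` collects everything with explicit constants;
  `lemma_3_5_bound_of_params` turns it into `≤ Cτη²X²/log X` given eight growth conditions in `X`,
  and `HeathBrown2001_lemma_3_5_of` verifies those for `τ = (log log X)^{-ϖ}` and `X ≥ X₀`
  (elementary: `log L ≤ 2√L`, `log L ≤ 8L^{1/8}`, `yⁿ/n! ≤ e^y`).

## Content (namespace `Literature.NumberTheory.Sieve.CubicSieve`), all proved

`prod_smallPrimes_ne_bot_and_isRough`, `TpieceB_eq`, `sum_inv_absNorm_primesAbove_large_le`,
`FLBound`/`exists_FLBound`, `WindowBound`, `CountBBound` (shapes of the tree inputs), `abs_roughWindow_sub_le`,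
`errB`, `abs_TpieceB_sub_le`, `abs_TpieceA_sub_le`, `coprime_prod_ratChain`, `sum_remaindersA_le`,
`mainTerms_eq`, `sum_abs_Tpiece_sub_le_explicit`, growth lemmas (`mul_pow_le_exp_of_le`,
`log_le_sqrt_and`, `hbTau_bounds`, `hbTau_le_of`, `exp_neg_inv_le_pow_five`, `sqrt_exp`, `rpow_third_le`),
`lemma_3_5_bound_of_params`, **`HeathBrown2001_lemma_3_5_of`**, **`HeathBrown2001_lemma_3_5_of_typeI_A`**.

## References

* D. R. Heath-Brown, *Primes represented by `x³ + 2y³`*, Acta Math. 186 (2001), 1–84: Lemma 3.5 (p. 13)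
  and §6, pp. 34–39. [cite: HeathBrownActa2001, Lemma 3.5 and §6]
* M. Rosen, *A generalization of Mertens' theorem*, J. Ramanujan Math. Soc. 14 (1999), 1–19, Thm 2
  (hypothesis `hmer`). [cite: Rosen1999Mertens, Thm 2]

## Mathlib / tree search

Mathlib: `Real.pow_div_factorial_le_exp`, `Real.log_le_rpow_div`, `Real.rpow_le_rpow_of_nonpos`,
`Real.add_one_le_exp`, `Finset.sum_biUnion`, `Finset.sum_product`, `Nat.Coprime.gcd_mul_left_cancel`,
`Nat.primeFactors_prod`, `Nat.squarefree_mul_iff`, `Ideal.IsPrime.prod_le`. Tree: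
`SieveSequence.fundamental_lemma_uniform_holds` (`SieveFrameworkFundamentalLemma`), `HeathBrownCubicFLSequencesA`
(`Tpiece_boxPairs_eq`, `abs_remainder_seqA_le`, `hasSieveDimension_densA`, `ratChains`),
`HeathBrownCubicFLRemaindersA` (`level_of_typeI_A`), `HeathBrownCubicFLSequencesB` (`famSifted_normWindow_eq`,
`card_isRough_sub_sifted_mem_Icc`, `card_idealWindow_dvd_eq_countB`), `HeathBrownCubicFLChains` (chain sums),
`HeathBrownCubicFLProducts` ((6.7), (6.9), Mertens), `HeathBrownCubicNormWindowSieve` (`windowSeq`,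
`hasSieveDimension_normDensity`, `sum_abs_remainder_windowSeq_le`, `exists_windowDvdCount_sub_le`,
`exists_prod_one_sub_normDensityAt_le`, `primesAbove`), `HeathBrownCubicSieveSetup` (`exists_countB_le`,
`idealsLE`), `HeathBrownCubicSieveDecomposition` (`Tpiece`, `chains`, `chainBound`, `hbTau`,
`HeathBrown2001_lemma_3_5`).
-/

noncomputable section

open Polynomial NumberField Finset Filter Topology

namespace Literature.NumberTheory.Sieve.CubicSieve

open LFunctions.CubeRootTwoField CubicPrimes
open Literature.NumberTheory.LFunctions (idealNormCount)

/-! ### The terms `T^(n)(ℬ)` through the window sequences -/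

/-- A product of members of `𝒫₀` is a nonzero `X^τ`-rough ideal. [folklore] -/
theorem prod_smallPrimes_ne_bot_and_isRough {X τ : ℝ} {s : Finset (Ideal (𝓞 K))} (hs : s ⊆ smallPrimes X τ) :
    (∏ P ∈ s, P) ≠ ⊥ ∧ IsRough (X ^ τ) (∏ P ∈ s, P) := by
  classical
  have hmem : ∀ P ∈ s, P.IsPrime ∧ P ≠ ⊥ ∧ X ^ τ ≤ (Ideal.absNorm P : ℝ) := fun P hP =>
    ⟨(mem_smallPrimes_iff.mp (hs hP)).1, (mem_smallPrimes_iff.mp (hs hP)).2.1, (mem_smallPrimes_iff.mp (hs hP)).2.2.1⟩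
  refine ⟨prod_ne_zero_iff.mpr fun P hP => (hmem P hP).2.1, fun Q hQ hQdvd => ?_⟩
  -- a prime dividing the product divides (hence equals) a member
  have hQle : ∏ P ∈ s, P ≤ Q := Ideal.le_of_dvd hQdvd
  obtain ⟨P, hP, hPQ⟩ := (Ideal.IsPrime.prod_le hQ).mp hQle
  have hP := hmem P hP
  have hPmax : P.IsMaximal := Ideal.IsPrime.isMaximal hP.1 hP.2.1
  rcases hPmax.eq_of_le hQ.ne_top hPQ with rfl
  exact hP.2.2

open scoped Classical in
/-- **`T^(n)(ℬ) = ∑_{s} #{J' : 3X³/N(∏s) < N(J') ≤ (1+η)3X³/N(∏s), J' X^τ-rough}`** (the exact reduction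
`famSifted_normWindow_eq` summed over the chains). [cite: HeathBrownActa2001, §6 (6.4)–(6.6)] -/
theorem TpieceB_eq (X η τ : ℝ) (n : ℕ) :
    (Tpiece (normWindow X η) (fun J => J) X τ n : ℝ) =
      ∑ s ∈ chains X τ n,
        (#{J' ∈ idealWindow (3 * X ^ 3 / Ideal.absNorm (∏ P ∈ s, P)) η | IsRough (X ^ τ) J'} : ℝ) := by
  rw [Tpiece, Nat.cast_sum]
  refine sum_congr rfl fun s hs => ?_
  obtain ⟨h0, hr⟩ := prod_smallPrimes_ne_bot_and_isRough (mem_chains_iff.mp hs).1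
  rw [famSifted_normWindow_eq h0 hr]

/-! ### The prime ideals of degree `≥ 2` above the small primes: `∑_{p<z}∑_{P∣p, N(P)≥z} N(P)^{-1} ≤ 9/√z` -/

open scoped Classical in
/-- **`∑_{p<z} ∑_{P∣p, N(P) ≥ z} N(P)^{-1} ≤ 9/√z`** for `z ≥ 4`: such `P` have `N(P) = p^f` with `f ≥ 2`,
so `N(P) ≥ max(p², z)`, and there are at most `3` of them above each `p`; split at `p ≤ √z`.
[cite: HeathBrownActa2001, §6 (6.4)–(6.5)] -/
theorem sum_inv_absNorm_primesAbove_large_le {z : ℝ} (hz : 4 ≤ z) :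
    ∑ p ∈ Nat.primesBelow ⌈z⌉₊, ∑ P ∈ (primesAbove p).filter (fun P => z ≤ (Ideal.absNorm P : ℝ)),
        ((Ideal.absNorm P : ℕ) : ℝ)⁻¹ ≤ 9 / Real.sqrt z := by
  have hz0 : 0 < z := by linarith
  have hsq : 2 ≤ Real.sqrt z := by
    rw [show (2 : ℝ) = Real.sqrt 4 by rw [show (4:ℝ) = 2 ^ 2 by norm_num, Real.sqrt_sq (by norm_num)]]
    exact Real.sqrt_le_sqrt hz
  have hsq0 : 0 < Real.sqrt z := by linarith
  have hsqz : Real.sqrt z * Real.sqrt z = z := Real.mul_self_sqrt hz0.le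
  -- per prime: the inner sum is `≤ 3 · min(1/p², 1/z)`
  have hinner : ∀ p ∈ Nat.primesBelow ⌈z⌉₊,
      ∑ P ∈ (primesAbove p).filter (fun P => z ≤ (Ideal.absNorm P : ℝ)), ((Ideal.absNorm P : ℕ) : ℝ)⁻¹ ≤
        3 * min ((p : ℝ) ^ 2)⁻¹ z⁻¹ := by
    intro p hp
    have hpp := Nat.prime_of_mem_primesBelow hp
    have hpz : (p : ℝ) < z := by
      have := (Nat.mem_primesBelow.mp hp).1
      have : (p : ℝ) < ⌈z⌉₊ := by exact_mod_cast this
      linarith [Nat.ceil_lt_add_one hz0.le, show (p : ℝ) ≤ ⌈z⌉₊ - 1 by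
        have h := (Nat.mem_primesBelow.mp hp).1
        have : (p : ℝ) + 1 ≤ ⌈z⌉₊ := by exact_mod_cast h
        linarith]
    have hp0 : (0 : ℝ) < p := by exact_mod_cast hpp.pos
    have hterm : ∀ P ∈ (primesAbove p).filter (fun P => z ≤ (Ideal.absNorm P : ℝ)),
        ((Ideal.absNorm P : ℕ) : ℝ)⁻¹ ≤ min ((p : ℝ) ^ 2)⁻¹ z⁻¹ := by
      intro P hP
      rw [mem_filter, mem_primesAbove_iff hpp] at hP
      obtain ⟨⟨hPp, hP0, hpN⟩, hzN⟩ := hP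
      obtain ⟨q, f, hq, hf, hN⟩ := exists_absNorm_eq_prime_pow' hPp hP0
      -- `q = p`
      have hqp : q = p := by
        have h1 : p ∣ q ^ f := hN ▸ hpN
        exact ((Nat.prime_dvd_prime_iff_eq hpp hq).mp (hpp.dvd_of_dvd_pow h1)).symm
      subst hqp
      have hf2 : 2 ≤ f := by
        by_contra hlt
        have hf1 : f = 1 := by omega
        rw [hf1, pow_one] at hN
        rw [hN] at hzN
        linarith
      have hNp2 : ((q : ℝ) ^ 2) ≤ (Ideal.absNorm P : ℕ) := by
        rw [hN]; exact_mod_cast Nat.pow_le_pow_right hq.pos hf2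
      have hNpos : (0 : ℝ) < (Ideal.absNorm P : ℕ) := by rw [hN]; exact_mod_cast pow_pos hq.pos f
      exact le_min (inv_anti₀ (by positivity) hNp2) (inv_anti₀ hz0 hzN)
    calc ∑ P ∈ (primesAbove p).filter (fun P => z ≤ (Ideal.absNorm P : ℝ)), ((Ideal.absNorm P : ℕ) : ℝ)⁻¹
        ≤ ∑ _P ∈ (primesAbove p).filter (fun P => z ≤ (Ideal.absNorm P : ℝ)), min ((p : ℝ) ^ 2)⁻¹ z⁻¹ :=
          sum_le_sum hterm
      _ = #((primesAbove p).filter (fun P => z ≤ (Ideal.absNorm P : ℝ))) * min ((p : ℝ) ^ 2)⁻¹ z⁻¹ := by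
          rw [sum_const, nsmul_eq_mul]
      _ ≤ 3 * min ((p : ℝ) ^ 2)⁻¹ z⁻¹ := by
          refine mul_le_mul_of_nonneg_right ?_ (by positivity)
          exact_mod_cast (card_filter_le _ _).trans (card_primesAbove_le hpp)
  -- split at `√z`
  set S := Nat.primesBelow ⌈z⌉₊ with hS
  set S₁ := S.filter (fun p : ℕ => (p : ℝ) ≤ Real.sqrt z) with hS₁
  set S₂ := S.filter (fun p : ℕ => ¬ (p : ℝ) ≤ Real.sqrt z) with hS₂
  have h1 : ∑ p ∈ S₁, 3 * min ((p : ℝ) ^ 2)⁻¹ z⁻¹ ≤ 3 / Real.sqrt z := by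
    calc ∑ p ∈ S₁, 3 * min ((p : ℝ) ^ 2)⁻¹ z⁻¹ ≤ ∑ _p ∈ S₁, 3 * z⁻¹ :=
          sum_le_sum fun p _ => mul_le_mul_of_nonneg_left (min_le_right _ _) (by norm_num)
      _ = #S₁ * (3 * z⁻¹) := by rw [sum_const, nsmul_eq_mul]
      _ ≤ Real.sqrt z * (3 * z⁻¹) := by
          refine mul_le_mul_of_nonneg_right ?_ (by positivity)
          have hsub : S₁ ⊆ Finset.Icc 1 ⌊Real.sqrt z⌋₊ := fun p hp => by
            rw [hS₁, mem_filter] at hp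
            rw [Finset.mem_Icc]
            exact ⟨(Nat.prime_of_mem_primesBelow hp.1).one_le, Nat.le_floor hp.2⟩
          calc (#S₁ : ℝ) ≤ #(Finset.Icc 1 ⌊Real.sqrt z⌋₊) := by exact_mod_cast card_le_card hsub
            _ = ⌊Real.sqrt z⌋₊ := by rw [Nat.card_Icc, Nat.add_sub_cancel]
            _ ≤ Real.sqrt z := Nat.floor_le hsq0.le
      _ = 3 / Real.sqrt z := by
          field_simp
          linarith [hsqz]
  have h2 : ∑ p ∈ S₂, 3 * min ((p : ℝ) ^ 2)⁻¹ z⁻¹ ≤ 6 / Real.sqrt z := by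
    calc ∑ p ∈ S₂, 3 * min ((p : ℝ) ^ 2)⁻¹ z⁻¹ ≤ ∑ p ∈ S₂, 3 * ((p : ℝ) ^ 2)⁻¹ :=
          sum_le_sum fun p _ => mul_le_mul_of_nonneg_left (min_le_left _ _) (by norm_num)
      _ = 3 * ∑ p ∈ S₂, ((p : ℝ) ^ 2)⁻¹ := by rw [mul_sum]
      _ ≤ 3 * (2 / Real.sqrt z) := by
          refine mul_le_mul_of_nonneg_left (sum_inv_sq_tail_le hsq _ fun p hp => ?_) (by norm_num)
          rw [hS₂, mem_filter] at hp
          exact lt_of_not_ge hp.2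
      _ = 6 / Real.sqrt z := by ring
  calc ∑ p ∈ S, ∑ P ∈ (primesAbove p).filter (fun P => z ≤ (Ideal.absNorm P : ℝ)), ((Ideal.absNorm P : ℕ) : ℝ)⁻¹
      ≤ ∑ p ∈ S, 3 * min ((p : ℝ) ^ 2)⁻¹ z⁻¹ := sum_le_sum hinner
    _ = ∑ p ∈ S₁, 3 * min ((p : ℝ) ^ 2)⁻¹ z⁻¹ + ∑ p ∈ S₂, 3 * min ((p : ℝ) ^ 2)⁻¹ z⁻¹ := by
        rw [hS₁, hS₂, sum_filter_add_sum_filter_not]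
    _ ≤ 3 / Real.sqrt z + 6 / Real.sqrt z := add_le_add h1 h2
    _ = 9 / Real.sqrt z := by ring


/-! ### The `ℬ`-side: Fundamental Lemma for the window sequences, chain by chain -/

/-- The shape of the tree's uniform Fundamental Lemma at dimension `3` with constant `K₀`, for a given
constant `C_FL` (an instance of `SieveSequence.fundamental_lemma_uniform_holds`). [folklore] -/
def FLBound (K₀ C_FL : ℝ) : Prop :=
  ∀ A : SieveSequence, HasSieveDimension A.density 3 K₀ →
    ∀ x z D : ℝ, 2 ≤ z → z ≤ D → 0 ≤ A.size x →
      |A.sifted x (primesProdBelow z) - A.size x * A.densityProduct (primesProdBelow z)| ≤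
        C_FL * A.size x * A.densityProduct (primesProdBelow z) * Real.exp (-(Real.log D / Real.log z)) +
          ∑ d ∈ (primesProdBelow z).divisors.filter (fun d : ℕ => (d : ℝ) ≤ D), |A.remainder d x|

/-- The Fundamental Lemma holds at dimension `3` for every constant `K` (tree:
`SieveSequence.fundamental_lemma_uniform_holds`). [folklore] -/
theorem exists_FLBound (K₀ : ℝ) : ∃ C_FL : ℝ, 0 < C_FL ∧ FLBound K₀ C_FL :=
  SieveSequence.fundamental_lemma_uniform_holds 3 K₀

/-- The shape of the Weber–Landau input of `HeathBrownCubicNormWindowSieve.exists_windowDvdCount_sub_le`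
for a given constant `C_W`. [folklore] -/
def WindowBound (C_W : ℝ) : Prop :=
  ∀ d : ℕ, Squarefree d → ∀ Y η : ℝ, 0 ≤ Y → 0 ≤ η → η ≤ 1 →
    |(windowDvdCount Y η d : ℝ) - gamma₀ * η * Y * normDensity d| ≤
      C_W * 8 ^ #d.primeFactors * (2 * Y / d + 1) ^ (2 / 3 : ℝ)

/-- The shape of the crude bound `#ℬ^(K)_R ≤ C_ℬ X³/N(R)` of `HeathBrownCubicSieveSetup.exists_countB_le`. [folklore] -/
def CountBBound (C_B : ℝ) : Prop :=
  ∀ X η : ℝ, 0 ≤ X → 0 ≤ η → η ≤ 1 → ∀ R : Ideal (𝓞 K), R ≠ ⊥ →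
    (countB X η R : ℝ) ≤ C_B * X ^ 3 / Ideal.absNorm R

open scoped Classical in
/-- **One chain of the `ℬ`-side.** For a nonzero `R` with `N(R) < X^{1+τ}` (`z = X^τ ≥ 4`,
`z ≤ D`, `0 ≤ η ≤ 1`, `X ≥ 1`), the count `#{J' : Y < N(J') ≤ Y(1+η), J' z-rough}`, `Y = 3X³/N(R)`, is
`γ₀ηY·V_ℬ(z)` up to
`[9C_ℬX³z^{-1/2} + C_FL·3γ₀ηX³V_ℬ(z)e^{-s} + C_W e^{32}(log z)^8((6X³)^{2/3}X^{(1+τ)/3}D^{1/3} + DX^{1+τ})]/N(R)`: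
the degree-`≥ 2` discrepancy (`card_isRough_sub_sifted_mem_Icc`, `#ℬ^(K)_{RP} ≤ C_ℬX³/(N(R)N(P))`,
`∑_{p<z}∑_{P} N(P)^{-1} ≤ 9/√z`), the Fundamental Lemma for the window sequence, and its remainders
(`sum_abs_remainder_windowSeq_le`, with `(2Y)^{2/3} ≤ (6X³)^{2/3}X^{(1+τ)/3}/N(R)`, `D ≤ DX^{1+τ}/N(R)`).
[cite: HeathBrownActa2001, §6 (6.4)–(6.6)] -/
theorem abs_roughWindow_sub_le {K₀ C_FL C_W C_B : ℝ} (hFL : FLBound K₀ C_FL) (hK : HasSieveDimension normDensity 3 K₀)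
    (hW : WindowBound C_W) (hCW : 0 ≤ C_W) (hB : CountBBound C_B)
    {X η τ D : ℝ} (hX : 1 ≤ X) (hη0 : 0 ≤ η) (hη1 : η ≤ 1) (hz : 4 ≤ X ^ τ) (hzD : X ^ τ ≤ D)
    {R : Ideal (𝓞 K)} (hR0 : R ≠ ⊥) (hRN : (Ideal.absNorm R : ℝ) < X ^ (1 + τ)) :
    |(#{J' ∈ idealWindow (3 * X ^ 3 / Ideal.absNorm R) η | IsRough (X ^ τ) J'} : ℝ) -
        3 * gamma₀ * η * X ^ 3 * prodB (X ^ τ) * ((Ideal.absNorm R : ℕ) : ℝ)⁻¹| ≤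
      (9 * C_B * X ^ 3 / Real.sqrt (X ^ τ) +
          C_FL * (3 * gamma₀ * η * X ^ 3) * prodB (X ^ τ) * Real.exp (-(Real.log D / Real.log (X ^ τ))) +
          C_W * (Real.exp 32 * Real.log (X ^ τ) ^ 8) *
            ((6 * X ^ 3) ^ (2 / 3 : ℝ) * X ^ ((1 + τ) / 3) * D ^ (1 / 3 : ℝ) + D * X ^ (1 + τ))) *
        ((Ideal.absNorm R : ℕ) : ℝ)⁻¹ := by
  set z := X ^ τ with hz'
  set N : ℝ := ((Ideal.absNorm R : ℕ) : ℝ) with hN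
  have hX0 : 0 < X := by linarith
  have hN0 : 0 < N := by
    have : Ideal.absNorm R ≠ 0 := fun h => hR0 (Ideal.absNorm_eq_zero_iff.mp h)
    rw [hN]; positivity
  set Y : ℝ := 3 * X ^ 3 / N with hY
  have hY0 : 0 ≤ Y := by positivity
  have hz2 : 2 ≤ z := by linarith
  have hz0 : 0 < z := by linarith
  have hD1 : 1 ≤ D := by linarith
  have hγ := gamma₀_pos
  obtain ⟨hPB0, hPB1⟩ := prodB_pos_le z
  -- (a) the degree ≥ 2 discrepancy
  have hdisc := card_isRough_sub_sifted_mem_Icc (Y := Y) (η := η) hY0 z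
  set SW := (windowSeq Y η).sifted (Y * (1 + η)) (primesProdBelow z) with hSW
  have hdisc_le : |(#{J' ∈ idealWindow Y η | IsRough z J'} : ℝ) - SW| ≤ C_B * X ^ 3 / N * (9 / Real.sqrt z) := by
    rw [abs_of_nonneg hdisc.1]
    refine hdisc.2.trans ?_
    have hcount : ∀ p ∈ Nat.primesBelow ⌈z⌉₊, ∀ P ∈ (primesAbove p).filter (fun P => z ≤ (Ideal.absNorm P : ℝ)),
        (#{J' ∈ idealWindow Y η | P ∣ J'} : ℝ) ≤ C_B * X ^ 3 / N * ((Ideal.absNorm P : ℕ) : ℝ)⁻¹ := by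
      intro p hp P hP
      have hpp := Nat.prime_of_mem_primesBelow hp
      rw [mem_filter, mem_primesAbove_iff hpp] at hP
      have hP0 : P ≠ ⊥ := hP.1.2.1
      rw [hY, card_idealWindow_dvd_eq_countB hR0 P]
      refine (hB X η hX0.le hη0 hη1 (R * P) (mul_ne_zero hR0 hP0)).trans (le_of_eq ?_)
      rw [map_mul, Nat.cast_mul, hN]
      field_simp
    calc ∑ p ∈ Nat.primesBelow ⌈z⌉₊, ∑ P ∈ (primesAbove p).filter (fun P => z ≤ (Ideal.absNorm P : ℝ)),
          (#{J' ∈ idealWindow Y η | P ∣ J'} : ℝ)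
        ≤ ∑ p ∈ Nat.primesBelow ⌈z⌉₊, ∑ P ∈ (primesAbove p).filter (fun P => z ≤ (Ideal.absNorm P : ℝ)),
            C_B * X ^ 3 / N * ((Ideal.absNorm P : ℕ) : ℝ)⁻¹ := sum_le_sum fun p hp => sum_le_sum (hcount p hp)
      _ = C_B * X ^ 3 / N * ∑ p ∈ Nat.primesBelow ⌈z⌉₊,
            ∑ P ∈ (primesAbove p).filter (fun P => z ≤ (Ideal.absNorm P : ℝ)), ((Ideal.absNorm P : ℕ) : ℝ)⁻¹ := by
          rw [mul_sum]; exact sum_congr rfl fun p _ => by rw [mul_sum]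
      _ ≤ C_B * X ^ 3 / N * (9 / Real.sqrt z) := by
          refine mul_le_mul_of_nonneg_left (sum_inv_absNorm_primesAbove_large_le hz) ?_
          -- `C_B ≥ 0` is forced by the bound at `R`: `0 ≤ countB ≤ C_B X³/N`
          have h := hB X η hX0.le hη0 hη1 R hR0
          have h0 : (0 : ℝ) ≤ countB X η R := Nat.cast_nonneg _
          have : 0 ≤ C_B * X ^ 3 / (Ideal.absNorm R : ℝ) := h0.trans h
          simpa [hN] using this
  -- (b) the Fundamental Lemma for the window sequence
  have hsize : 0 ≤ (windowSeq Y η).size (Y * (1 + η)) := by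
    show 0 ≤ gamma₀ * η * Y; positivity
  have hFLw := hFL (windowSeq Y η) hK (Y * (1 + η)) z D hz2 hzD hsize
  rw [densityProduct_windowSeq] at hFLw
  have hsizeq : (windowSeq Y η).size (Y * (1 + η)) = gamma₀ * η * Y := rfl
  rw [hsizeq] at hFLw
  have hrem := sum_abs_remainder_windowSeq_le hW hY0 hη0 hη1 hz2 hD1 (le_refl (Y * (1 + η))) hCW
  -- (c) sizes in terms of `1/N`
  have hmain_eq : gamma₀ * η * Y * prodB z = 3 * gamma₀ * η * X ^ 3 * prodB z * N⁻¹ := by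
    rw [hY]; field_simp
  have hXpow : N < X ^ (1 + τ) := hRN
  have hXpow0 : 0 < X ^ (1 + τ) := Real.rpow_pos_of_pos hX0 _
  have hY23 : (2 * Y) ^ (2 / 3 : ℝ) ≤ (6 * X ^ 3) ^ (2 / 3 : ℝ) * X ^ ((1 + τ) / 3) * N⁻¹ := by
    have h2Y : 2 * Y = 6 * X ^ 3 / N := by rw [hY]; ring
    rw [h2Y, Real.div_rpow (by positivity) hN0.le]
    -- `N^{-2/3} = N^{1/3} N^{-1} ≤ X^{(1+τ)/3} N^{-1}`
    have hN13 : N ^ (1 / 3 : ℝ) ≤ X ^ ((1 + τ) / 3) := by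
      calc N ^ (1 / 3 : ℝ) ≤ (X ^ (1 + τ)) ^ (1 / 3 : ℝ) := Real.rpow_le_rpow hN0.le hXpow.le (by norm_num)
        _ = X ^ ((1 + τ) / 3) := by rw [← Real.rpow_mul hX0.le]; ring_nf
    have hNsplit : ((N) ^ (2 / 3 : ℝ))⁻¹ = N ^ (1 / 3 : ℝ) * N⁻¹ := by
      rw [← Real.rpow_neg hN0.le, ← Real.rpow_neg_one N, ← Real.rpow_add hN0]; norm_num
    rw [div_eq_mul_inv, hNsplit, ← mul_assoc]
    have h6 : 0 ≤ (6 * X ^ 3) ^ (2 / 3 : ℝ) := by positivity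
    calc (6 * X ^ 3) ^ (2 / 3 : ℝ) * N ^ (1 / 3 : ℝ) * N⁻¹ ≤ (6 * X ^ 3) ^ (2 / 3 : ℝ) * X ^ ((1 + τ) / 3) * N⁻¹ := by
          gcongr
    _ = _ := rfl
  have hDle : D ≤ D * X ^ (1 + τ) * N⁻¹ := by
    rw [mul_assoc, le_mul_iff_one_le_right (by linarith), ← div_eq_mul_inv, one_le_div hN0]
    exact hXpow.le
  have hlogz8 : 0 ≤ Real.exp 32 * Real.log z ^ 8 := by
    have : 0 ≤ Real.log z := Real.log_nonneg (by linarith)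
    positivity
  have hrem' : ∑ d ∈ (primesProdBelow z).divisors.filter (fun d : ℕ => (d : ℝ) ≤ D), |(windowSeq Y η).remainder d (Y * (1 + η))| ≤
      C_W * (Real.exp 32 * Real.log z ^ 8) * ((6 * X ^ 3) ^ (2 / 3 : ℝ) * X ^ ((1 + τ) / 3) * D ^ (1 / 3 : ℝ) + D * X ^ (1 + τ)) * N⁻¹ := by
    refine hrem.trans ?_
    have hD13 : 0 ≤ D ^ (1 / 3 : ℝ) := by positivity
    have h1 : (2 * Y) ^ (2 / 3 : ℝ) * D ^ (1 / 3 : ℝ) + D ≤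
        ((6 * X ^ 3) ^ (2 / 3 : ℝ) * X ^ ((1 + τ) / 3) * D ^ (1 / 3 : ℝ) + D * X ^ (1 + τ)) * N⁻¹ := by
      rw [add_mul]
      refine add_le_add ?_ (by simpa [mul_assoc] using hDle)
      calc (2 * Y) ^ (2 / 3 : ℝ) * D ^ (1 / 3 : ℝ) ≤ ((6 * X ^ 3) ^ (2 / 3 : ℝ) * X ^ ((1 + τ) / 3) * N⁻¹) * D ^ (1 / 3 : ℝ) :=
            mul_le_mul_of_nonneg_right hY23 hD13
        _ = (6 * X ^ 3) ^ (2 / 3 : ℝ) * X ^ ((1 + τ) / 3) * D ^ (1 / 3 : ℝ) * N⁻¹ := by ring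
    calc C_W * ((2 * Y) ^ (2 / 3 : ℝ) * D ^ (1 / 3 : ℝ) + D) * (Real.exp 32 * Real.log z ^ 8)
        = C_W * (Real.exp 32 * Real.log z ^ 8) * ((2 * Y) ^ (2 / 3 : ℝ) * D ^ (1 / 3 : ℝ) + D) := by ring
      _ ≤ C_W * (Real.exp 32 * Real.log z ^ 8) *
            (((6 * X ^ 3) ^ (2 / 3 : ℝ) * X ^ ((1 + τ) / 3) * D ^ (1 / 3 : ℝ) + D * X ^ (1 + τ)) * N⁻¹) :=
          mul_le_mul_of_nonneg_left h1 (mul_nonneg hCW hlogz8)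
      _ = _ := by ring
  -- assemble
  have hFL' : |SW - 3 * gamma₀ * η * X ^ 3 * prodB z * N⁻¹| ≤
      C_FL * (3 * gamma₀ * η * X ^ 3) * prodB z * Real.exp (-(Real.log D / Real.log z)) * N⁻¹ +
        C_W * (Real.exp 32 * Real.log z ^ 8) *
          ((6 * X ^ 3) ^ (2 / 3 : ℝ) * X ^ ((1 + τ) / 3) * D ^ (1 / 3 : ℝ) + D * X ^ (1 + τ)) * N⁻¹ := by
    rw [← hmain_eq]
    refine hFLw.trans (add_le_add (le_of_eq ?_) hrem')
    rw [hY]; field_simp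
  calc |(#{J' ∈ idealWindow Y η | IsRough z J'} : ℝ) - 3 * gamma₀ * η * X ^ 3 * prodB z * N⁻¹|
      = |((#{J' ∈ idealWindow Y η | IsRough z J'} : ℝ) - SW) + (SW - 3 * gamma₀ * η * X ^ 3 * prodB z * N⁻¹)| := by
        ring_nf
    _ ≤ |(#{J' ∈ idealWindow Y η | IsRough z J'} : ℝ) - SW| + |SW - 3 * gamma₀ * η * X ^ 3 * prodB z * N⁻¹| :=
        abs_add_le _ _
    _ ≤ C_B * X ^ 3 / N * (9 / Real.sqrt z) +
          (C_FL * (3 * gamma₀ * η * X ^ 3) * prodB z * Real.exp (-(Real.log D / Real.log z)) * N⁻¹ +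
            C_W * (Real.exp 32 * Real.log z ^ 8) *
              ((6 * X ^ 3) ^ (2 / 3 : ℝ) * X ^ ((1 + τ) / 3) * D ^ (1 / 3 : ℝ) + D * X ^ (1 + τ)) * N⁻¹) :=
        add_le_add hdisc_le hFL'
    _ = _ := by rw [div_eq_mul_inv _ N]; ring


/-- The `ℬ`-side error factor
`Q_ℬ = 9C_ℬX³z^{-1/2} + 3C_FLγ₀ηX³V_ℬ(z)e^{-s} + C_We^{32}(log z)^8((6X³)^{2/3}X^{(1+τ)/3}D^{1/3} + DX^{1+τ})`. [folklore] -/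
def errB (C_FL C_W C_B X η τ D : ℝ) : ℝ :=
  9 * C_B * X ^ 3 / Real.sqrt (X ^ τ) +
    C_FL * (3 * gamma₀ * η * X ^ 3) * prodB (X ^ τ) * Real.exp (-(Real.log D / Real.log (X ^ τ))) +
    C_W * (Real.exp 32 * Real.log (X ^ τ) ^ 8) *
      ((6 * X ^ 3) ^ (2 / 3 : ℝ) * X ^ ((1 + τ) / 3) * D ^ (1 / 3 : ℝ) + D * X ^ (1 + τ))

/-- **`|T^(n)(ℬ) − 3γ₀ηX³V_ℬ(z)Σ₁(n)| ≤ Q_ℬ·Σ₁(n)`** (summing `abs_roughWindow_sub_le` over the chains of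
(3.1), through `TpieceB_eq`). [cite: HeathBrownActa2001, §6 (6.6)] -/
theorem abs_TpieceB_sub_le {K₀ C_FL C_W C_B : ℝ} (hFL : FLBound K₀ C_FL) (hK : HasSieveDimension normDensity 3 K₀)
    (hW : WindowBound C_W) (hCW : 0 ≤ C_W) (hB : CountBBound C_B)
    {X η τ D : ℝ} (hX : 1 ≤ X) (hη0 : 0 ≤ η) (hη1 : η ≤ 1) (hz : 4 ≤ X ^ τ) (hzD : X ^ τ ≤ D) (n : ℕ) :
    |(Tpiece (normWindow X η) (fun J => J) X τ n : ℝ) - 3 * gamma₀ * η * X ^ 3 * prodB (X ^ τ) * chainSumB X τ n| ≤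
      errB C_FL C_W C_B X η τ D * chainSumB X τ n := by
  classical
  rw [TpieceB_eq, chainSumB, mul_sum, mul_sum, ← sum_sub_distrib]
  refine (abs_sum_le_sum_abs _ _).trans (sum_le_sum fun s hs => ?_)
  obtain ⟨hsub, -, hlt⟩ := mem_chains_iff.mp hs
  obtain ⟨h0, -⟩ := prod_smallPrimes_ne_bot_and_isRough hsub
  exact abs_roughWindow_sub_le hFL hK hW hCW hB hX hη0 hη1 hz hzD h0 hlt

/-! ### The `𝒜`-side: Fundamental Lemma for `𝒜_q`, chain by chain -/

open scoped Classical in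
/-- **`|T^(n)(𝒜) − (6η²X²/π²)V_𝒜(z)Σ₀(n)| ≤ C_FL(6η²X²/π²)V_𝒜(z)e^{-s}Σ₀(n) + ∑_{t}∑_{d∣P(z), d≤D}|R_d(𝒜_{∏t})|`**
(the Fundamental Lemma for each `𝒜_q`, `q = ∏t`, `t ∈ ratChains n`, through (6.1) = `Tpiece_boxPairs_eq`;
(6.3) with the error made explicit). [cite: HeathBrownActa2001, §6 (6.2)–(6.3)] -/
theorem abs_TpieceA_sub_le {C_FL : ℝ} (hFL : FLBound dimConst C_FL)
    {X η τ D : ℝ} (hX : 0 ≤ X) (hz : 2 ≤ X ^ τ) (hzD : X ^ τ ≤ D) (n : ℕ) :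
    |(Tpiece (boxPairs X η) pairIdeal X τ n : ℝ) - sizeA X η * prodA (X ^ τ) * chainSumA X τ n| ≤
      C_FL * sizeA X η * prodA (X ^ τ) * Real.exp (-(Real.log D / Real.log (X ^ τ))) * chainSumA X τ n +
        ∑ t ∈ ratChains X τ n, ∑ d ∈ (primesProdBelow (X ^ τ)).divisors.filter (fun d : ℕ => (d : ℝ) ≤ D),
          |(seqA X η (∏ p ∈ t, p)).remainder d (topA X η)| := by
  rw [Tpiece_boxPairs_eq hX, chainSumA, mul_sum, mul_sum, ← sum_sub_distrib, ← sum_add_distrib]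
  refine (abs_sum_le_sum_abs _ _).trans (sum_le_sum fun t _ => ?_)
  set q := ∏ p ∈ t, p
  have hsize : 0 ≤ (seqA X η q).size (topA X η) := by
    show 0 ≤ sizeA X η * densA q
    exact mul_nonneg (sizeA_nonneg X η) (densA_nonneg q)
  have h := hFL (seqA X η q) hasSieveDimension_densA (topA X η) (X ^ τ) D hz hzD hsize
  rw [densityProduct_seqA] at h
  have hsz : (seqA X η q).size (topA X η) = sizeA X η * densA q := rfl
  rw [hsz] at h
  rw [show sizeA X η * prodA (X ^ τ) * densA q = sizeA X η * densA q * prodA (X ^ τ) by ring]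
  refine h.trans (le_of_eq ?_)
  ring


/-! ### The `𝒜`-remainders: the moduli `r = qd` are distinct square-free numbers `≤ X^{1+τ}D` -/

/-- The rational chain `t` (primes `≥ X^τ`) and a divisor `d` of `P(X^τ)` (primes `< X^τ`) are coprime,
and `∏t · d` is square-free. [folklore] -/
theorem coprime_prod_ratChain {X τ : ℝ} {n : ℕ} {t : Finset ℕ} (ht : t ∈ ratChains X τ n) {d : ℕ}
    (hd : d ∣ primesProdBelow (X ^ τ)) : (∏ p ∈ t, p).Coprime d ∧ Squarefree ((∏ p ∈ t, p) * d) := by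
  obtain ⟨htsub, -, -⟩ := mem_ratChains_iff.mp ht
  have htp : ∀ p ∈ t, p.Prime := fun p hp => (mem_ratSmallPrimes_iff.mp (htsub hp)).1
  have hcop : (∏ p ∈ t, p).Coprime d := by
    refine Nat.coprime_of_dvd fun k hk hkq hkd => ?_
    obtain ⟨p, hp, hkp⟩ := (Nat.Prime.prime hk).dvd_finsetProd_iff _ |>.mp hkq
    have hkp' : k = p := (Nat.prime_dvd_prime_iff_eq hk (htp p hp)).mp hkp
    subst hkp'
    have h1 : X ^ τ ≤ (k : ℝ) := (mem_ratSmallPrimes_iff.mp (htsub hp)).2.1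
    have h2 : (k : ℝ) < X ^ τ := (dvd_primesProdBelow_iff hk (X ^ τ)).mp (hkd.trans hd)
    linarith
  refine ⟨hcop, Nat.squarefree_mul_iff.mpr ⟨hcop, ?_, (squarefree_primesProdBelow _).squarefree_of_dvd hd⟩⟩
  -- a product of distinct primes is square-free
  · have hpf : (∏ p ∈ t, p).primeFactors = t := Nat.primeFactors_prod htp
    have hne : ∏ p ∈ t, p ≠ 0 := prod_ne_zero_iff.mpr fun p hp => (htp p hp).ne_zero
    rw [Nat.squarefree_iff_prime_squarefree] at *
    intro p hp hsq
    -- `p² ∣ ∏t` forces `p ∣ ∏_{t \ {p}} ` hence `p = p'` for some other member: contradiction by coprimality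
    have hpt : p ∈ t := by
      rw [← hpf]; exact Nat.mem_primeFactors.mpr ⟨hp, (dvd_mul_right p p).trans hsq, hne⟩
    rw [← mul_prod_erase t (fun p => p) hpt] at hsq
    have h2 : p ∣ ∏ q ∈ t.erase p, q := by
      have := (Nat.mul_dvd_mul_iff_left hp.pos).mp hsq
      exact this
    obtain ⟨q, hq, hpq⟩ := (Nat.Prime.prime hp).dvd_finsetProd_iff _ |>.mp h2
    have hqp : p = q := (Nat.prime_dvd_prime_iff_eq hp (htp q (mem_of_mem_erase hq))).mp hpq
    exact (ne_of_mem_erase hq) hqp.symm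

open scoped Classical in
/-- **The `𝒜`-remainders are controlled by the level of distribution.** For `X ≥ 1` and `DX^{1+τ} ≤ X^{3/2}`:
`∑_{n<N}∑_{t ∈ ratChains n}∑_{d∣P(X^τ), d≤D} |R_d(𝒜_{∏t})| ≤ ∑_{N(R) ≤ X^{3/2}, N(R) square-free} |#𝒜^(K)_R − (6η²X²/π²)ρ₂(R)/N(R)|`
(each `R_d(𝒜_q)` is a sum over the ideals of norm `qd`, `abs_remainder_seqA_le`; the moduli `qd` are
square-free, `≤ X^{1+τ}D`, and DISTINCT: `d = (qd, P(z))` and `t` = the prime factors of `q` —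
"summing over `q` as well as `d`" on p. 35). [cite: HeathBrownActa2001, §6 p. 35] -/
theorem sum_remaindersA_le {X η τ D : ℝ} (hX : 1 ≤ X) (hD : D * X ^ (1 + τ) ≤ X ^ (3 / 2 : ℝ)) (N : ℕ) :
    ∑ n ∈ range N, ∑ t ∈ ratChains X τ n,
        ∑ d ∈ (primesProdBelow (X ^ τ)).divisors.filter (fun d : ℕ => (d : ℝ) ≤ D),
          |(seqA X η (∏ p ∈ t, p)).remainder d (topA X η)| ≤
      ∑ R ∈ (idealsLE ⌊X ^ (3 / 2 : ℝ)⌋₊).filter (fun R => Squarefree (Ideal.absNorm R)),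
        |(countA X η R : ℝ) - sizeA X η * rho₂ R / Ideal.absNorm R| := by
  set z := X ^ τ with hz
  set Dset := (primesProdBelow z).divisors.filter (fun d : ℕ => (d : ℝ) ≤ D) with hDset
  set g : Ideal (𝓞 K) → ℝ := fun R => |(countA X η R : ℝ) - sizeA X η * rho₂ R / Ideal.absNorm R| with hg
  have hg0 : ∀ R, 0 ≤ g R := fun R => abs_nonneg _
  have hX0 : 0 ≤ X := by linarith
  -- Step 1: each remainder through the ideals of norm `qd`
  have hstep1 : ∀ n, ∀ t ∈ ratChains X τ n, ∀ d ∈ Dset,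
      |(seqA X η (∏ p ∈ t, p)).remainder d (topA X η)| ≤ ∑ R ∈ normEq ((∏ p ∈ t, p) * d), g R := by
    intro n t ht d hd
    have hdP : d ∣ primesProdBelow z := Nat.dvd_of_mem_divisors (mem_filter.mp hd).1
    exact abs_remainder_seqA_le hX0 η (coprime_prod_ratChain ht hdP).2
  -- Step 2: flatten the index set
  set U := (range N).biUnion (fun n => ratChains X τ n) with hU
  have hUdisj : (↑(range N) : Set ℕ).PairwiseDisjoint (fun n => ratChains X τ n) := by
    intro n _ m _ hnm
    rw [Function.onFun, Finset.disjoint_left]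
    intro t ht ht'
    exact hnm ((mem_ratChains_iff.mp ht).2.1.symm.trans (mem_ratChains_iff.mp ht').2.1)
  set f : Finset ℕ × ℕ → ℕ := fun x => (∏ p ∈ x.1, p) * x.2 with hf
  -- injectivity of `(t, d) ↦ ∏t·d` on `U × Dset`
  have hinj : Set.InjOn f ↑(U ×ˢ Dset) := by
    rintro ⟨t, d⟩ hx ⟨t', d'⟩ hx' heq
    simp only [coe_product, Set.mem_prod, mem_coe, hU, mem_biUnion] at hx hx'
    obtain ⟨⟨n, -, ht⟩, hd⟩ := hx
    obtain ⟨⟨n', -, ht'⟩, hd'⟩ := hx'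
    have hdP : d ∣ primesProdBelow z := Nat.dvd_of_mem_divisors (mem_filter.mp hd).1
    have hdP' : d' ∣ primesProdBelow z := Nat.dvd_of_mem_divisors (mem_filter.mp hd').1
    have hc := (coprime_prod_ratChain ht hdP).1
    have hc' := (coprime_prod_ratChain ht' hdP').1
    simp only [hf] at heq
    -- `d = gcd(∏t·d, P(z)) = d'`
    have hcP : (∏ p ∈ t, p).Coprime (primesProdBelow z) := by
      refine Nat.coprime_of_dvd fun k hk hkq hkP => ?_
      obtain ⟨htsub, -, -⟩ := mem_ratChains_iff.mp ht
      obtain ⟨p, hp, hkp⟩ := (Nat.Prime.prime hk).dvd_finsetProd_iff _ |>.mp hkq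
      have hkp' : k = p := (Nat.prime_dvd_prime_iff_eq hk (mem_ratSmallPrimes_iff.mp (htsub hp)).1).mp hkp
      subst hkp'
      have h1 : X ^ τ ≤ (k : ℝ) := (mem_ratSmallPrimes_iff.mp (htsub hp)).2.1
      have h2 : (k : ℝ) < X ^ τ := (dvd_primesProdBelow_iff hk (X ^ τ)).mp hkP
      linarith
    have hcP' : (∏ p ∈ t', p).Coprime (primesProdBelow z) := by
      refine Nat.coprime_of_dvd fun k hk hkq hkP => ?_
      obtain ⟨htsub, -, -⟩ := mem_ratChains_iff.mp ht'
      obtain ⟨p, hp, hkp⟩ := (Nat.Prime.prime hk).dvd_finsetProd_iff _ |>.mp hkq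
      have hkp' : k = p := (Nat.prime_dvd_prime_iff_eq hk (mem_ratSmallPrimes_iff.mp (htsub hp)).1).mp hkp
      subst hkp'
      have h1 : X ^ τ ≤ (k : ℝ) := (mem_ratSmallPrimes_iff.mp (htsub hp)).2.1
      have h2 : (k : ℝ) < X ^ τ := (dvd_primesProdBelow_iff hk (X ^ τ)).mp hkP
      linarith
    have hdd : d = d' := by
      have e1 : ((∏ p ∈ t, p) * d).gcd (primesProdBelow z) = d := by
        rw [Nat.Coprime.gcd_mul_left_cancel d hcP, Nat.gcd_eq_left hdP]
      have e2 : ((∏ p ∈ t', p) * d').gcd (primesProdBelow z) = d' := by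
        rw [Nat.Coprime.gcd_mul_left_cancel d' hcP', Nat.gcd_eq_left hdP']
      rw [← e1, ← e2, heq]
    subst hdd
    have hd0 : d ≠ 0 := fun h => primesProdBelow_ne_zero z (by rw [h] at hdP; exact zero_dvd_iff.mp hdP)
    have hqq : ∏ p ∈ t, p = ∏ p ∈ t', p := Nat.eq_of_mul_eq_mul_right (Nat.pos_of_ne_zero hd0) heq
    have htt : t = t' := by
      have h1 := Nat.primeFactors_prod fun p hp => (mem_ratSmallPrimes_iff.mp ((mem_ratChains_iff.mp ht).1 hp)).1
      have h2 := Nat.primeFactors_prod fun p hp => (mem_ratSmallPrimes_iff.mp ((mem_ratChains_iff.mp ht').1 hp)).1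
      rw [← h1, ← h2, hqq]
    rw [htt]
  -- the fibres `normEq (f x)` are pairwise disjoint on `U × Dset`
  have hdisj : (↑(U ×ˢ Dset) : Set (Finset ℕ × ℕ)).PairwiseDisjoint (fun x => normEq (f x)) := by
    intro x hx y hy hxy
    rw [Function.onFun, Finset.disjoint_left]
    intro R hR hR'
    rw [mem_normEq] at hR hR'
    exact hxy (hinj hx hy (hR.symm.trans hR'))
  -- the union of the fibres lies in the target set
  have hsub : (U ×ˢ Dset).biUnion (fun x => normEq (f x)) ⊆
      (idealsLE ⌊X ^ (3 / 2 : ℝ)⌋₊).filter (fun R => Squarefree (Ideal.absNorm R)) := by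
    intro R hR
    rw [mem_biUnion] at hR
    obtain ⟨⟨t, d⟩, hx, hR⟩ := hR
    rw [mem_product, hU, mem_biUnion] at hx
    obtain ⟨⟨n, -, ht⟩, hd⟩ := hx
    rw [mem_normEq] at hR
    have hdP : d ∣ primesProdBelow z := Nat.dvd_of_mem_divisors (mem_filter.mp hd).1
    have hdD : (d : ℝ) ≤ D := (mem_filter.mp hd).2
    obtain ⟨-, -, hlt⟩ := mem_ratChains_iff.mp ht
    rw [mem_filter, mem_idealsLE, hR]
    refine ⟨Nat.le_floor ?_, (coprime_prod_ratChain ht hdP).2⟩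
    simp only [hf]
    push_cast
    have hlt' : (∏ i ∈ t, (i : ℝ)) < X ^ (1 + τ) := by rw [← Nat.cast_prod]; exact hlt
    have hq0 : (0 : ℝ) ≤ ∏ i ∈ t, (i : ℝ) := prod_nonneg fun i _ => Nat.cast_nonneg i
    have hd0 : (0 : ℝ) ≤ d := Nat.cast_nonneg _
    calc (∏ i ∈ t, (i : ℝ)) * d ≤ X ^ (1 + τ) * D := mul_le_mul hlt'.le hdD hd0 (by positivity)
      _ ≤ X ^ (3 / 2 : ℝ) := by rw [mul_comm]; exact hD
  -- put everything together
  calc ∑ n ∈ range N, ∑ t ∈ ratChains X τ n, ∑ d ∈ Dset, |(seqA X η (∏ p ∈ t, p)).remainder d (topA X η)|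
      ≤ ∑ n ∈ range N, ∑ t ∈ ratChains X τ n, ∑ d ∈ Dset, ∑ R ∈ normEq ((∏ p ∈ t, p) * d), g R :=
        sum_le_sum fun n _ => sum_le_sum fun t ht => sum_le_sum fun d hd => hstep1 n t ht d hd
    _ = ∑ t ∈ U, ∑ d ∈ Dset, ∑ R ∈ normEq ((∏ p ∈ t, p) * d), g R := by rw [hU, sum_biUnion hUdisj]
    _ = ∑ x ∈ U ×ˢ Dset, ∑ R ∈ normEq (f x), g R := by rw [sum_product]
    _ = ∑ R ∈ (U ×ˢ Dset).biUnion (fun x => normEq (f x)), g R := (sum_biUnion hdisj).symm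
    _ ≤ _ := sum_le_sum_of_subset_of_nonneg hsub fun R _ _ => hg0 R


/-! ### The main terms: `M_𝒜(n) − κM_ℬ(n) = η²X²[(6/π²)V_𝒜Σ₀(n) − σ₀γ₀V_ℬΣ₁(n)]` -/

/-- The algebra of the main terms: `(6η²X²/π²)V_𝒜Σ₀ − κ·3γ₀ηX³V_ℬΣ₁ = η²X²{(6/π²)V_𝒜Σ₀ − σ₀γ₀V_ℬΣ₁}`
(`κ = σ₀η/(3X)`), split as `[(6/π²)V_𝒜 − σ₀V]Σ₀ + σ₀[V − γ₀V_ℬ]Σ₁ + σ₀V[Σ₀ − Σ₁]`.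
[cite: HeathBrownActa2001, §6 p. 39] -/
theorem mainTerms_eq {σ₀ X η : ℝ} (hX : X ≠ 0) (PA PB V S₀ S₁ : ℝ) :
    sizeA X η * PA * S₀ - kappa σ₀ X η * (3 * gamma₀ * η * X ^ 3 * PB * S₁) =
      η ^ 2 * X ^ 2 * ((6 / Real.pi ^ 2 * PA - σ₀ * V) * S₀ + σ₀ * (V - gamma₀ * PB) * S₁ + σ₀ * V * (S₀ - S₁)) := by
  rw [sizeA, kappa]
  field_simp
  ring

/-- **The comparison of Lemma 3.5 with all constants explicit** (before the choice of parameters). For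
`X ≥ 1`, `0 ≤ η ≤ 1`, `z = X^τ ≥ 16` in the range of (6.7) and (6.9), `z ≤ D`, `DX^{1+τ} ≤ X^{3/2}`:
`∑_{n<N} |T^(n)(𝒜) − κT^(n)(ℬ)| ≤ C_𝒜(6η²X²/π²)V_𝒜e^{-s}e^{W₁} + [level sum] + κQ_ℬe^{W₁}
  + η²X²e^{W₁}{C₇V/log z + σ₀C₉V/log z + σ₀V(W₁X^{-τ} + 12(z/2)^{-1/3} + 54(z/2)^{-1})}`
(`V = ∏_{p<z}(1−1/p)`, `W₁ = ∑_{P∈𝒫₀}N(P)^{-1}`), combining `abs_TpieceA_sub_le`, `sum_remaindersA_le`,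
`abs_TpieceB_sub_le`, `mainTerms_eq`, (6.7), (6.9) and the chain-sum estimates of `HeathBrownCubicFLChains`.
[cite: HeathBrownActa2001, §6 pp. 35–39] -/
theorem sum_abs_Tpiece_sub_le_explicit {σ₀ : ℝ} (hσ₀ : 0 < σ₀)
    {C_A : ℝ} (hFLA : FLBound dimConst C_A) (hCA : 0 ≤ C_A)
    {K₀ C_FL C_W C_B : ℝ} (hFLB : FLBound K₀ C_FL) (hCFL : 0 ≤ C_FL) (hK : HasSieveDimension normDensity 3 K₀)
    (hW : WindowBound C_W) (hCW : 0 ≤ C_W) (hB : CountBBound C_B) (hCB : 0 ≤ C_B)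
    {C₇ z₇ : ℝ} (h7 : ∀ z : ℝ, z₇ ≤ z → |6 / Real.pi ^ 2 * prodA z - σ₀ * mertensProd z| ≤ C₇ * mertensProd z / Real.log z)
    {C₉ z₉ : ℝ} (h9 : ∀ z : ℝ, z₉ ≤ z → |gamma₀ * prodB z - mertensProd z| ≤ C₉ * mertensProd z / Real.log z)
    {X η τ D : ℝ} (hX : 1 ≤ X) (hη0 : 0 ≤ η) (hη1 : η ≤ 1) (hz16 : 16 ≤ X ^ τ) (hz7 : z₇ ≤ X ^ τ) (hz9 : z₉ ≤ X ^ τ)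
    (hzD : X ^ τ ≤ D) (hD : D * X ^ (1 + τ) ≤ X ^ (3 / 2 : ℝ)) (N : ℕ) :
    ∑ n ∈ range N, |(Tpiece (boxPairs X η) pairIdeal X τ n : ℝ) -
        kappa σ₀ X η * Tpiece (normWindow X η) (fun J => J) X τ n| ≤
      C_A * sizeA X η * prodA (X ^ τ) * Real.exp (-(Real.log D / Real.log (X ^ τ))) * Real.exp (smallPrimesWeight X τ) +
        ∑ R ∈ (idealsLE ⌊X ^ (3 / 2 : ℝ)⌋₊).filter (fun R => Squarefree (Ideal.absNorm R)),
          |(countA X η R : ℝ) - sizeA X η * rho₂ R / Ideal.absNorm R| +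
        kappa σ₀ X η * (errB C_FL C_W C_B X η τ D * Real.exp (smallPrimesWeight X τ)) +
        η ^ 2 * X ^ 2 * Real.exp (smallPrimesWeight X τ) *
          (C₇ * mertensProd (X ^ τ) / Real.log (X ^ τ) + σ₀ * (C₉ * mertensProd (X ^ τ) / Real.log (X ^ τ)) +
            σ₀ * mertensProd (X ^ τ) *
              (smallPrimesWeight X τ * (X ^ τ)⁻¹ + 12 / (X ^ τ / 2) ^ (1 / 3 : ℝ) + 54 / (X ^ τ / 2))) := by
  set z := X ^ τ with hz
  set W := smallPrimesWeight X τ with hWdef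
  set V := mertensProd z with hV
  set κ := kappa σ₀ X η with hκ
  set PA := prodA z with hPA
  set PB := prodB z with hPB
  set E := Real.exp (-(Real.log D / Real.log z)) with hE
  have hX0 : 0 < X := by linarith
  have hκ0 : 0 ≤ κ := by rw [hκ, kappa]; positivity
  obtain ⟨hV0, hV1⟩ := mertensProd_pos_le z
  obtain ⟨hPA0, hPA1⟩ := prodA_pos_le z
  have hsA := sizeA_nonneg X η
  have hE0 : 0 ≤ E := (Real.exp_pos _).le
  -- per-`n` decomposition
  set TA : ℕ → ℝ := fun n => (Tpiece (boxPairs X η) pairIdeal X τ n : ℝ) with hTA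
  set TB : ℕ → ℝ := fun n => (Tpiece (normWindow X η) (fun J => J) X τ n : ℝ) with hTB
  set S₀ := chainSumA X τ with hS₀
  set S₁ := chainSumB X τ with hS₁
  set remA : ℕ → ℝ := fun n => ∑ t ∈ ratChains X τ n,
    ∑ d ∈ (primesProdBelow z).divisors.filter (fun d : ℕ => (d : ℝ) ≤ D), |(seqA X η (∏ p ∈ t, p)).remainder d (topA X η)|
    with hremA
  have hA : ∀ n, |TA n - sizeA X η * PA * S₀ n| ≤ C_A * sizeA X η * PA * E * S₀ n + remA n := fun n =>
    abs_TpieceA_sub_le hFLA hX0.le (by linarith) hzD n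
  have hBn : ∀ n, |TB n - 3 * gamma₀ * η * X ^ 3 * PB * S₁ n| ≤ errB C_FL C_W C_B X η τ D * S₁ n := fun n =>
    abs_TpieceB_sub_le hFLB hK hW hCW hB hX hη0 hη1 (by linarith) hzD n
  have hM : ∀ n, |sizeA X η * PA * S₀ n - κ * (3 * gamma₀ * η * X ^ 3 * PB * S₁ n)| ≤
      η ^ 2 * X ^ 2 * (C₇ * V / Real.log z * S₀ n + σ₀ * (C₉ * V / Real.log z) * S₁ n + σ₀ * V * |S₀ n - S₁ n|) := by
    intro n
    rw [hκ, mainTerms_eq hX0.ne' PA PB V (S₀ n) (S₁ n), abs_mul, abs_of_nonneg (by positivity)]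
    refine mul_le_mul_of_nonneg_left ?_ (by positivity)
    have hS₀0 : 0 ≤ S₀ n := chainSumA_nonneg X τ n
    have hS₁0 : 0 ≤ S₁ n := chainSumB_nonneg X τ n
    have e7 := h7 z hz7
    have e9 := h9 z hz9
    calc |(6 / Real.pi ^ 2 * PA - σ₀ * V) * S₀ n + σ₀ * (V - gamma₀ * PB) * S₁ n + σ₀ * V * (S₀ n - S₁ n)|
        ≤ |(6 / Real.pi ^ 2 * PA - σ₀ * V) * S₀ n| + |σ₀ * (V - gamma₀ * PB) * S₁ n| + |σ₀ * V * (S₀ n - S₁ n)| :=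
          (abs_add_le _ _).trans (add_le_add (abs_add_le _ _) le_rfl)
      _ ≤ C₇ * V / Real.log z * S₀ n + σ₀ * (C₉ * V / Real.log z) * S₁ n + σ₀ * V * |S₀ n - S₁ n| := by
          refine add_le_add (add_le_add ?_ ?_) (le_of_eq ?_)
          · rw [abs_mul, abs_of_nonneg hS₀0]
            exact mul_le_mul_of_nonneg_right e7 hS₀0
          · rw [abs_mul, abs_mul, abs_of_pos hσ₀, abs_of_nonneg hS₁0, abs_sub_comm]
            exact mul_le_mul_of_nonneg_right (mul_le_mul_of_nonneg_left e9 hσ₀.le) hS₁0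
          · rw [abs_mul, abs_of_nonneg (mul_nonneg hσ₀.le hV0.le)]
  have hpt : ∀ n, |TA n - κ * TB n| ≤
      (C_A * sizeA X η * PA * E * S₀ n + remA n) + κ * (errB C_FL C_W C_B X η τ D * S₁ n) +
        η ^ 2 * X ^ 2 * (C₇ * V / Real.log z * S₀ n + σ₀ * (C₉ * V / Real.log z) * S₁ n + σ₀ * V * |S₀ n - S₁ n|) := by
    intro n
    have hsplit : TA n - κ * TB n = (TA n - sizeA X η * PA * S₀ n) - κ * (TB n - 3 * gamma₀ * η * X ^ 3 * PB * S₁ n) +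
        (sizeA X η * PA * S₀ n - κ * (3 * gamma₀ * η * X ^ 3 * PB * S₁ n)) := by ring
    rw [hsplit]
    refine (abs_add_le _ _).trans (add_le_add ((abs_sub _ _).trans (add_le_add (hA n) ?_)) (hM n))
    rw [abs_mul, abs_of_nonneg hκ0]
    exact mul_le_mul_of_nonneg_left (hBn n) hκ0
  -- sum over `n`
  have hsumS₀ : ∑ n ∈ range N, S₀ n ≤ Real.exp W := sum_chainSumA_le_exp hX τ N
  have hsumS₁ : ∑ n ∈ range N, S₁ n ≤ Real.exp W := sum_chainSumB_le_exp X τ N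
  have hsumdiff : ∑ n ∈ range N, |S₀ n - S₁ n| ≤ Real.exp W * (W * z⁻¹ + 12 / (z / 2) ^ (1 / 3 : ℝ) + 54 / (z / 2)) :=
    sum_abs_chainSumA_sub_chainSumB_le hX (by linarith) (by linarith) N
  have hsumrem : ∑ n ∈ range N, remA n ≤ ∑ R ∈ (idealsLE ⌊X ^ (3 / 2 : ℝ)⌋₊).filter (fun R => Squarefree (Ideal.absNorm R)),
      |(countA X η R : ℝ) - sizeA X η * rho₂ R / Ideal.absNorm R| := sum_remaindersA_le hX hD N
  have hlogz : 0 < Real.log z := Real.log_pos (by linarith)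
  have herrB : 0 ≤ errB C_FL C_W C_B X η τ D := by
    rw [errB]
    have hD0 : 0 < D := by linarith
    have : 0 ≤ Real.log (X ^ τ) := Real.log_nonneg (by linarith)
    have := (prodB_pos_le (X ^ τ)).1
    have := gamma₀_pos
    positivity
  have hsumB : ∑ n ∈ range N, κ * (errB C_FL C_W C_B X η τ D * S₁ n) ≤ κ * (errB C_FL C_W C_B X η τ D * Real.exp W) := by
    rw [← mul_sum, ← mul_sum]
    exact mul_le_mul_of_nonneg_left (mul_le_mul_of_nonneg_left hsumS₁ herrB) hκ0
  calc ∑ n ∈ range N, |TA n - κ * TB n|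
      ≤ ∑ n ∈ range N, ((C_A * sizeA X η * PA * E * S₀ n + remA n) + κ * (errB C_FL C_W C_B X η τ D * S₁ n) +
          η ^ 2 * X ^ 2 * (C₇ * V / Real.log z * S₀ n + σ₀ * (C₉ * V / Real.log z) * S₁ n + σ₀ * V * |S₀ n - S₁ n|)) :=
        sum_le_sum fun n _ => hpt n
    _ = C_A * sizeA X η * PA * E * ∑ n ∈ range N, S₀ n + ∑ n ∈ range N, remA n +
          ∑ n ∈ range N, κ * (errB C_FL C_W C_B X η τ D * S₁ n) +
          η ^ 2 * X ^ 2 * (C₇ * V / Real.log z * ∑ n ∈ range N, S₀ n +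
            σ₀ * (C₉ * V / Real.log z) * ∑ n ∈ range N, S₁ n + σ₀ * V * ∑ n ∈ range N, |S₀ n - S₁ n|) := by
        simp only [sum_add_distrib, mul_sum, mul_add]
    _ ≤ C_A * sizeA X η * PA * E * Real.exp W +
          ∑ R ∈ (idealsLE ⌊X ^ (3 / 2 : ℝ)⌋₊).filter (fun R => Squarefree (Ideal.absNorm R)),
            |(countA X η R : ℝ) - sizeA X η * rho₂ R / Ideal.absNorm R| +
          κ * (errB C_FL C_W C_B X η τ D * Real.exp W) +
          η ^ 2 * X ^ 2 * (C₇ * V / Real.log z * Real.exp W + σ₀ * (C₉ * V / Real.log z) * Real.exp W +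
            σ₀ * V * (Real.exp W * (W * z⁻¹ + 12 / (z / 2) ^ (1 / 3 : ℝ) + 54 / (z / 2)))) := by
        have hC7 : 0 ≤ C₇ * V / Real.log z := by
          -- from (6.7) at `z`: `0 ≤ |…| ≤ C₇ V/log z`
          exact (abs_nonneg _).trans (h7 z hz7)
        have hC9 : 0 ≤ σ₀ * (C₉ * V / Real.log z) :=
          mul_nonneg hσ₀.le ((abs_nonneg _).trans (h9 z hz9))
        have hσV : 0 ≤ σ₀ * V := mul_nonneg hσ₀.le hV0.le
        gcongr
    _ = _ := by ring


/-! ### Elementary growth lemmas for the choice of parameters -/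

/-- `A yⁿ ≤ e^y` once `y ≥ (n+1)!·A` (`y ≥ 0`). [folklore] -/
theorem mul_pow_le_exp_of_le {A y : ℝ} {n : ℕ} (hy0 : 0 ≤ y) (hy : ((n + 1).factorial : ℝ) * A ≤ y) :
    A * y ^ n ≤ Real.exp y := by
  have h := Real.pow_div_factorial_le_exp y hy0 (n + 1)
  have hf : (0 : ℝ) < (n + 1).factorial := by positivity
  calc A * y ^ n ≤ (y / (n + 1).factorial) * y ^ n := by
        refine mul_le_mul_of_nonneg_right ?_ (pow_nonneg hy0 n)
        rw [le_div_iff₀ hf]; linarith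
    _ = y ^ (n + 1) / (n + 1).factorial := by rw [pow_succ]; ring
    _ ≤ Real.exp y := h

/-- `log L ≤ 2√L` and `log L ≤ 8 L^{1/8}` for `L ≥ 0`. [folklore] -/
theorem log_le_sqrt_and {L : ℝ} (hL : 0 ≤ L) : Real.log L ≤ 2 * Real.sqrt L ∧ Real.log L ≤ 8 * L ^ (1 / 8 : ℝ) := by
  constructor
  · have h := Real.log_le_rpow_div hL (show (0 : ℝ) < 1 / 2 by norm_num)
    rw [Real.sqrt_eq_rpow]; linarith [show L ^ (1 / 2 : ℝ) / (1 / 2) = 2 * L ^ (1 / 2 : ℝ) by ring]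
  · have h := Real.log_le_rpow_div hL (show (0 : ℝ) < 1 / 8 by norm_num)
    linarith [show L ^ (1 / 8 : ℝ) / (1 / 8) = 8 * L ^ (1 / 8 : ℝ) by ring]

/-- Basic bounds for `τ = (log log X)^{-ϖ}`: for `0 < ϖ ≤ 1` and `log log X ≥ 1`, `0 < τ ≤ 1` and
`τ ≥ (log log X)^{-1}`. [cite: HeathBrownActa2001, §3 (3.4)] -/
theorem hbTau_bounds {ϖ X : ℝ} (hϖ0 : 0 < ϖ) (hϖ1 : ϖ ≤ 1) (hℓ : 1 ≤ Real.log (Real.log X)) :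
    0 < hbTau ϖ X ∧ hbTau ϖ X ≤ 1 ∧ (Real.log (Real.log X))⁻¹ ≤ hbTau ϖ X := by
  have hℓ0 : 0 < Real.log (Real.log X) := by linarith
  refine ⟨Real.rpow_pos_of_pos hℓ0 _, Real.rpow_le_one_of_one_le_of_nonpos hℓ (by linarith), ?_⟩
  rw [hbTau, ← Real.rpow_neg_one]
  exact Real.rpow_le_rpow_of_exponent_le hℓ (by linarith)

/-- `τ ≤ c` as soon as `log log X ≥ c^{-1/ϖ}` (`c > 0`). [folklore] -/
theorem hbTau_le_of {ϖ X c : ℝ} (hϖ0 : 0 < ϖ) (hc : 0 < c) (hℓ : c ^ (-(1 / ϖ)) ≤ Real.log (Real.log X)) :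
    hbTau ϖ X ≤ c := by
  have hc0 : 0 < c ^ (-(1 / ϖ)) := Real.rpow_pos_of_pos hc _
  rw [hbTau]
  calc Real.log (Real.log X) ^ (-ϖ) ≤ (c ^ (-(1 / ϖ))) ^ (-ϖ) :=
        Real.rpow_le_rpow_of_nonpos hc0 hℓ (by linarith)
    _ = c := by
        rw [← Real.rpow_mul hc.le, show -(1 / ϖ) * -ϖ = 1 by field_simp, Real.rpow_one]

/-- `e^{-1/(4τ)} ≤ τ⁵` once `τ^{-1} ≥ 4⁶·720` (`e^{u/4} ≥ (u/4)⁶/6! ≥ u⁵`). [folklore] -/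
theorem exp_neg_inv_le_pow_five {τ : ℝ} (hτ : 0 < τ) (hbig : (4 : ℝ) ^ 6 * 720 ≤ τ⁻¹) :
    Real.exp (-(1 / (4 * τ))) ≤ τ ^ 5 := by
  set u := τ⁻¹ with hu
  have hu0 : 0 < u := inv_pos.mpr hτ
  have hτu : τ = u⁻¹ := by rw [hu, inv_inv]
  have h := Real.pow_div_factorial_le_exp (u / 4) (by positivity) 6
  rw [show ((Nat.factorial 6 : ℕ) : ℝ) = 720 by norm_num [Nat.factorial]] at h
  have hkey : u ^ 5 ≤ Real.exp (u / 4) := by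
    calc u ^ 5 ≤ (u / 4) ^ 6 / 720 := by
          rw [div_pow, le_div_iff₀ (by norm_num), div_eq_mul_inv]
          have : u ^ 5 * ((4 : ℝ) ^ 6 * 720) ≤ u ^ 5 * u := mul_le_mul_of_nonneg_left hbig (by positivity)
          nlinarith
      _ ≤ Real.exp (u / 4) := h
  have h1 : Real.exp (-(1 / (4 * τ))) = (Real.exp (u / 4))⁻¹ := by
    rw [← Real.exp_neg, hτu]; congr 1; field_simp
  rw [h1, hτu, inv_pow]
  exact inv_anti₀ (by positivity) hkey

/-- `log` of `X ≥ e^{e}` has `log log X ≥ 1`; and `X ≥ X₀ := exp L₀` gives `log X ≥ L₀`. [folklore] -/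
private theorem le_log_of_exp_le {L₀ X : ℝ} (h : Real.exp L₀ ≤ X) : L₀ ≤ Real.log X := by
  have hX : 0 < X := lt_of_lt_of_le (Real.exp_pos _) h
  rw [← Real.log_exp L₀]; exact Real.log_le_log (Real.exp_pos _) h


/-! ### The bound of Lemma 3.5 from the explicit comparison, given the parameter inequalities -/

set_option maxHeartbeats 800000 in
/-- **Lemma 3.5 with level `D = X^{1/4}`, given the parameter inequalities.** With `z = X^τ`, `L = log X`,
`0 < τ ≤ 1/4`, `e^{-L^{1/3}} ≤ η ≤ 1` and the eight growth conditions `(E1)–(E8)` below (all of which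
hold for `τ = (log log X)^{-ϖ}` and `X` large, `HeathBrown2001_lemma_3_5_of`), the explicit comparison
`sum_abs_Tpiece_sub_le_explicit` gives `∑_n |T^(n)(𝒜) − κT^(n)(ℬ)| ≤ C τη²X²/log X`. The four groups of
terms are estimated as on pp. 38–39: the Fundamental-Lemma main errors through `e^{-s} = e^{-1/(4τ)} ≤ τ⁵`,
`V_𝒜, V_ℬ ≪ 1/log z`, `e^{W₁} ≤ e³/τ`; the `𝒜`-remainders by the level of distribution; the
`ℬ`-discrepancy and `ℬ`-remainders by the power savings `z^{-1/2}`, `X^{-1/2}`; and the main terms by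
(6.7), (6.9), `V ≤ 14/log z` and `∑_n|Σ₀ − Σ₁| ≪ e^{W₁}τ^{-1}z^{-1/3}`. [cite: HeathBrownActa2001, §6 pp. 38–39] -/
theorem lemma_3_5_bound_of_params {σ₀ : ℝ} (hσ₀ : 0 < σ₀)
    {C_A : ℝ} (hFLA : FLBound dimConst C_A) (hCA : 0 ≤ C_A)
    {K₀ C_FL C_W C_B : ℝ} (hFLB : FLBound K₀ C_FL) (hCFL : 0 ≤ C_FL) (hK : HasSieveDimension normDensity 3 K₀)
    (hW : WindowBound C_W) (hCW : 0 ≤ C_W) (hB : CountBBound C_B) (hCB : 0 ≤ C_B)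
    {C₇ z₇ : ℝ} (hC7 : 0 ≤ C₇)
    (h7 : ∀ z : ℝ, z₇ ≤ z → |6 / Real.pi ^ 2 * prodA z - σ₀ * mertensProd z| ≤ C₇ * mertensProd z / Real.log z)
    {C₉ z₉ : ℝ} (hC9 : 0 ≤ C₉)
    (h9 : ∀ z : ℝ, z₉ ≤ z → |gamma₀ * prodB z - mertensProd z| ≤ C₉ * mertensProd z / Real.log z)
    {C_PA z_PA : ℝ} (hCPA : 0 ≤ C_PA) (hPA : ∀ z : ℝ, z_PA ≤ z → prodA z ≤ C_PA / Real.log z)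
    {K_V : ℝ} (hKV : ∀ z : ℝ, 2 ≤ z → prodB z ≤ K_V / Real.log z)
    {C₁ : ℝ} (hW1 : ∀ X τ : ℝ, 1 < X → 0 < τ → τ ≤ 1 / 2 → (2 : ℝ) ^ 10 ≤ X ^ τ →
      2 * C₁ ≤ τ * Real.log X → smallPrimesWeight X τ ≤ Real.log (1 / τ) + 3)
    {θ C_L : ℝ} {X η τ : ℝ}
    (hLEV : ∑ R ∈ (idealsLE ⌊X ^ (3 / 2 : ℝ)⌋₊).filter (fun R => Squarefree (Ideal.absNorm R)),
        |(countA X η R : ℝ) - sizeA X η * rho₂ R / Ideal.absNorm R| ≤ C_L * X ^ θ)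
    (hX : 3 ≤ X) (hτ0 : 0 < τ) (hτ4 : τ ≤ 1 / 4)
    (hηlo : Real.exp (-Real.log X ^ (1 / 3 : ℝ)) ≤ η) (hη1 : η ≤ 1)
    (hz16 : 16 ≤ X ^ τ) (hz7 : z₇ ≤ X ^ τ) (hz9 : z₉ ≤ X ^ τ) (hzPA : z_PA ≤ X ^ τ) (hz10 : (2 : ℝ) ^ 10 ≤ X ^ τ)
    (hC1 : 2 * C₁ ≤ τ * Real.log X)
    (hE3 : Real.exp (-(1 / (4 * τ))) ≤ τ ^ 5)
    (hE4 : 14 * Real.exp 3 * (C₇ + σ₀ * C₉) ≤ τ ^ 4 * Real.log X)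
    (hE5 : 1904 * σ₀ * Real.exp 3 ≤ τ ^ 4 * (X ^ τ) ^ (1 / 3 : ℝ))
    (hE6 : 3 * σ₀ * Real.exp 3 * C_B * Real.log X ≤ τ ^ 2 * Real.sqrt (X ^ τ) * Real.exp (-Real.log X ^ (1 / 3 : ℝ)))
    (hE7 : 2 * σ₀ * Real.exp 35 * C_W * Real.log X ^ 9 ≤ τ ^ 2 * Real.sqrt X * Real.exp (-Real.log X ^ (1 / 3 : ℝ)))
    (hE8 : C_L * Real.log X * Real.exp (2 * Real.log X ^ (1 / 3 : ℝ)) * X ^ θ ≤ τ * X ^ 2) (N : ℕ) :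
    ∑ n ∈ range N, |(Tpiece (boxPairs X η) pairIdeal X τ n : ℝ) -
        kappa σ₀ X η * Tpiece (normWindow X η) (fun J => J) X τ n| ≤
      (C_A * C_PA * Real.exp 3 + σ₀ * Real.exp 3 * C_FL * gamma₀ * K_V + 5) * τ * η ^ 2 * X ^ 2 / Real.log X := by
  -- notation and basic positivity
  set L := Real.log X with hL
  set z := X ^ τ with hz
  set D := X ^ (1 / 4 : ℝ) with hD
  have hX1 : 1 < X := by linarith
  have hX0 : 0 < X := by linarith
  have hL1 : 1 ≤ L := by
    rw [hL, ← Real.log_exp 1]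
    exact Real.log_le_log (Real.exp_pos 1) (by linarith [Real.exp_one_lt_d9])
  have hL0 : 0 < L := by linarith
  have hη0 : 0 < η := lt_of_lt_of_le (Real.exp_pos _) hηlo
  have hτ1 : τ ≤ 1 := by linarith
  have hlogz : Real.log z = τ * L := by rw [hz, Real.log_rpow hX0]
  have hlogD : Real.log D = L / 4 := by rw [hD, Real.log_rpow hX0]; ring
  have hτL0 : 0 < τ * L := mul_pos hτ0 hL0
  have hz0 : 0 < z := by linarith
  have hzD : z ≤ D := by
    rw [hz, hD]; exact Real.rpow_le_rpow_of_exponent_le hX1.le hτ4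
  have hD' : D * X ^ (1 + τ) ≤ X ^ (3 / 2 : ℝ) := by
    rw [hD, ← Real.rpow_add hX0]
    exact Real.rpow_le_rpow_of_exponent_le hX1.le (by linarith)
  have hs : Real.exp (-(Real.log D / Real.log z)) = Real.exp (-(1 / (4 * τ))) := by
    rw [hlogD, hlogz]; congr 2; field_simp
  -- `e^{W₁} ≤ e³/τ` and `W₁ ≤ 1/τ + 3`
  set W := smallPrimesWeight X τ with hWdef
  have hWle : W ≤ Real.log (1 / τ) + 3 := hW1 X τ hX1 hτ0 (by linarith) hz10 hC1
  have hWle' : W ≤ 1 / τ + 3 := by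
    have : Real.log (1 / τ) ≤ 1 / τ := (Real.log_le_sub_one_of_pos (by positivity)).trans (by linarith)
    linarith
  have heW : Real.exp W ≤ Real.exp 3 / τ := by
    calc Real.exp W ≤ Real.exp (Real.log (1 / τ) + 3) := Real.exp_le_exp.mpr hWle
      _ = Real.exp 3 / τ := by rw [Real.exp_add, Real.exp_log (by positivity)]; field_simp
  have heW0 : 0 < Real.exp W := Real.exp_pos W
  -- the explicit comparison
  have hmaster := sum_abs_Tpiece_sub_le_explicit hσ₀ hFLA hCA hFLB hCFL hK hW hCW hB hCB h7 h9 hX1.le hη0.le hη1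
    hz16 hz7 hz9 hzD hD' N
  rw [hs] at hmaster
  -- the unit
  set U := τ * η ^ 2 * X ^ 2 / L with hU
  have hU0 : 0 < U := by positivity
  -- products
  have hV := mertensProd_le (show (2 : ℝ) ≤ z by linarith)
  obtain ⟨hV0, -⟩ := mertensProd_pos_le z
  have hPAle : prodA z ≤ C_PA / (τ * L) := by rw [← hlogz]; exact hPA z hzPA
  have hPBle : prodB z ≤ K_V / (τ * L) := by rw [← hlogz]; exact hKV z (by linarith)
  obtain ⟨hPA0, -⟩ := prodA_pos_le z
  obtain ⟨hPB0, -⟩ := prodB_pos_le z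
  have hKV0 : 0 ≤ K_V := by
    have := hPB0.le.trans hPBle
    rwa [le_div_iff₀ hτL0, zero_mul] at this
  rw [hlogz] at hV
  -- Group 1: the FL main error on the `𝒜`-side
  have hsizeA : sizeA X η ≤ η ^ 2 * X ^ 2 := by
    rw [sizeA, div_le_iff₀ (by positivity)]
    have hpi : (6 : ℝ) ≤ Real.pi ^ 2 := by nlinarith only [Real.pi_gt_three]
    have h0 : 0 ≤ η ^ 2 * X ^ 2 := by positivity
    have := mul_le_mul_of_nonneg_left hpi h0
    linarith only [this]
  have hG1 : C_A * sizeA X η * prodA z * Real.exp (-(1 / (4 * τ))) * Real.exp W ≤ C_A * C_PA * Real.exp 3 * U := by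
    calc C_A * sizeA X η * prodA z * Real.exp (-(1 / (4 * τ))) * Real.exp W
        ≤ C_A * (η ^ 2 * X ^ 2) * (C_PA / (τ * L)) * τ ^ 5 * (Real.exp 3 / τ) := by
          gcongr
    _ = C_A * C_PA * Real.exp 3 * U * τ ^ 2 := by rw [hU]; field_simp
    _ ≤ C_A * C_PA * Real.exp 3 * U * 1 := by
          refine mul_le_mul_of_nonneg_left (pow_le_one₀ hτ0.le hτ1) (by positivity)
    _ = _ := mul_one _
  -- Group 2: the level of distribution
  have hG2 : ∑ R ∈ (idealsLE ⌊X ^ (3 / 2 : ℝ)⌋₊).filter (fun R => Squarefree (Ideal.absNorm R)),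
      |(countA X η R : ℝ) - sizeA X η * rho₂ R / Ideal.absNorm R| ≤ U := by
    refine hLEV.trans ?_
    -- `C_L X^θ ≤ τ e^{-2L^{1/3}} X²/L ≤ U`
    have hexp : Real.exp (-L ^ (1 / 3 : ℝ)) ^ 2 ≤ η ^ 2 := pow_le_pow_left₀ (Real.exp_pos _).le hηlo 2
    have h1 : C_L * X ^ θ ≤ τ * X ^ 2 * Real.exp (-L ^ (1 / 3 : ℝ)) ^ 2 / L := by
      rw [le_div_iff₀ hL0, ← Real.exp_nat_mul, show ((2 : ℕ) : ℝ) * -L ^ (1 / 3 : ℝ) = -(2 * L ^ (1 / 3 : ℝ)) by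
        push_cast; ring, Real.exp_neg]
      have hE := Real.exp_pos (2 * L ^ (1 / 3 : ℝ))
      rw [← div_eq_mul_inv, le_div_iff₀ hE]
      calc C_L * X ^ θ * L * Real.exp (2 * L ^ (1 / 3 : ℝ)) = C_L * L * Real.exp (2 * L ^ (1 / 3 : ℝ)) * X ^ θ := by ring
        _ ≤ τ * X ^ 2 := hE8
    calc C_L * X ^ θ ≤ τ * X ^ 2 * Real.exp (-L ^ (1 / 3 : ℝ)) ^ 2 / L := h1
      _ ≤ τ * X ^ 2 * η ^ 2 / L := by gcongr
      _ = U := by rw [hU]; ring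
  -- Group 3: the `ℬ`-side through `κ e^{W₁} ≤ σ₀ηe³/(3Xτ)`
  have hκ : kappa σ₀ X η * Real.exp W ≤ σ₀ * η * Real.exp 3 / (3 * X * τ) := by
    rw [kappa]
    calc σ₀ * η / (3 * X) * Real.exp W ≤ σ₀ * η / (3 * X) * (Real.exp 3 / τ) :=
          mul_le_mul_of_nonneg_left heW (by positivity)
      _ = _ := by field_simp
  have hκ0 : 0 ≤ kappa σ₀ X η := by rw [kappa]; positivity
  -- (3a) discrepancy
  have hG3a : σ₀ * η * Real.exp 3 / (3 * X * τ) * (9 * C_B * X ^ 3 / Real.sqrt z) ≤ U := by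
    have hsq0 : 0 < Real.sqrt z := Real.sqrt_pos.mpr hz0
    -- `= 3σ₀e³C_B ηX² τ⁻¹ z^{-1/2}` and `3σ₀e³C_B L ≤ τ²√z e^{-L^{1/3}} ≤ τ²√z η`
    have hkey : 3 * σ₀ * Real.exp 3 * C_B * L ≤ τ ^ 2 * Real.sqrt z * η :=
      hE6.trans (mul_le_mul_of_nonneg_left hηlo (by positivity))
    have hXne : X ≠ 0 := hX0.ne'
    have hτne : τ ≠ 0 := hτ0.ne'
    have hLne : L ≠ 0 := hL0.ne'
    have hsqne : Real.sqrt z ≠ 0 := hsq0.ne'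
    calc σ₀ * η * Real.exp 3 / (3 * X * τ) * (9 * C_B * X ^ 3 / Real.sqrt z)
        = (3 * σ₀ * Real.exp 3 * C_B * L) * (η * X ^ 2 / (L * τ * Real.sqrt z)) := by field_simp; ring
      _ ≤ (τ ^ 2 * Real.sqrt z * η) * (η * X ^ 2 / (L * τ * Real.sqrt z)) :=
          mul_le_mul_of_nonneg_right hkey (by positivity)
      _ = U := by rw [hU]; field_simp
  -- (3b) FL main error on the `ℬ`-side
  have hG3b : σ₀ * η * Real.exp 3 / (3 * X * τ) *
      (C_FL * (3 * gamma₀ * η * X ^ 3) * prodB z * Real.exp (-(1 / (4 * τ)))) ≤ σ₀ * Real.exp 3 * C_FL * gamma₀ * K_V * U := by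
    have hγ := gamma₀_pos
    calc σ₀ * η * Real.exp 3 / (3 * X * τ) * (C_FL * (3 * gamma₀ * η * X ^ 3) * prodB z * Real.exp (-(1 / (4 * τ))))
        ≤ σ₀ * η * Real.exp 3 / (3 * X * τ) * (C_FL * (3 * gamma₀ * η * X ^ 3) * (K_V / (τ * L)) * τ ^ 5) := by
          gcongr
      _ = σ₀ * Real.exp 3 * C_FL * gamma₀ * K_V * U * τ ^ 2 := by rw [hU]; field_simp
      _ ≤ σ₀ * Real.exp 3 * C_FL * gamma₀ * K_V * U * 1 :=
          mul_le_mul_of_nonneg_left (pow_le_one₀ hτ0.le hτ1) (by positivity)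
      _ = _ := mul_one _
  -- (3c) the `ℬ`-remainders
  have hG3c : σ₀ * η * Real.exp 3 / (3 * X * τ) * (C_W * (Real.exp 32 * Real.log z ^ 8) *
      ((6 * X ^ 3) ^ (2 / 3 : ℝ) * X ^ ((1 + τ) / 3) * D ^ (1 / 3 : ℝ) + D * X ^ (1 + τ))) ≤ U := by
    -- the bracket is `≤ 5 X^{5/2}`
    have h6 : (6 * X ^ 3) ^ (2 / 3 : ℝ) ≤ 4 * X ^ 2 := by
      rw [Real.mul_rpow (by norm_num) (by positivity), show (X ^ 3 : ℝ) = X ^ (3 : ℝ) by norm_cast,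
        ← Real.rpow_mul hX0.le, show (3 : ℝ) * (2 / 3) = 2 by norm_num, show X ^ (2 : ℝ) = X ^ 2 by norm_cast]
      refine mul_le_mul_of_nonneg_right ?_ (by positivity)
      -- `6^{2/3} ≤ 4` since `6² ≤ 4³`
      have : (6 : ℝ) ^ (2 / 3 : ℝ) = ((6 : ℝ) ^ (2 : ℝ)) ^ (1 / 3 : ℝ) := by rw [← Real.rpow_mul (by norm_num)]; norm_num
      rw [this, show (4 : ℝ) = ((64 : ℝ)) ^ (1 / 3 : ℝ) by
        rw [show (64 : ℝ) = 4 ^ (3 : ℝ) by norm_num, ← Real.rpow_mul (by norm_num)]; norm_num]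
      exact Real.rpow_le_rpow (by positivity) (by norm_num) (by norm_num)
    have hX53 : X ^ ((1 + τ) / 3) ≤ X ^ (5 / 12 : ℝ) := Real.rpow_le_rpow_of_exponent_le hX1.le (by linarith)
    have hD13 : D ^ (1 / 3 : ℝ) = X ^ (1 / 12 : ℝ) := by rw [hD, ← Real.rpow_mul hX0.le]; norm_num
    have hDX : D * X ^ (1 + τ) ≤ X ^ (5 / 2 : ℝ) := by
      rw [hD, ← Real.rpow_add hX0]; exact Real.rpow_le_rpow_of_exponent_le hX1.le (by linarith)
    have hbr : (6 * X ^ 3) ^ (2 / 3 : ℝ) * X ^ ((1 + τ) / 3) * D ^ (1 / 3 : ℝ) + D * X ^ (1 + τ) ≤ 5 * X ^ (5 / 2 : ℝ) := by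
      have h1 : (6 * X ^ 3) ^ (2 / 3 : ℝ) * X ^ ((1 + τ) / 3) * D ^ (1 / 3 : ℝ) ≤ 4 * X ^ (5 / 2 : ℝ) := by
        rw [hD13]
        calc (6 * X ^ 3) ^ (2 / 3 : ℝ) * X ^ ((1 + τ) / 3) * X ^ (1 / 12 : ℝ)
            ≤ (4 * X ^ 2) * X ^ (5 / 12 : ℝ) * X ^ (1 / 12 : ℝ) := by gcongr
          _ = 4 * X ^ (5 / 2 : ℝ) := by
              rw [show (X ^ 2 : ℝ) = X ^ (2 : ℝ) by norm_cast, mul_assoc, mul_assoc, ← Real.rpow_add hX0,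
                ← Real.rpow_add hX0]
              norm_num
      linarith
    have hlogz8 : Real.log z ^ 8 ≤ L ^ 8 := by
      rw [hlogz]; exact pow_le_pow_left₀ hτL0.le (by nlinarith) 8
    have hsqrtX : Real.sqrt X = X ^ (1 / 2 : ℝ) := Real.sqrt_eq_rpow X
    -- `2σ₀e^{35}C_W L^9 ≤ τ² √X e^{-L^{1/3}} ≤ τ²√X η`
    have hkey : 2 * σ₀ * Real.exp 35 * C_W * L ^ 9 ≤ τ ^ 2 * Real.sqrt X * η :=
      hE7.trans (mul_le_mul_of_nonneg_left hηlo (by positivity))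
    have hX52 : X ^ (5 / 2 : ℝ) = X ^ 2 * Real.sqrt X := by
      rw [hsqrtX, show (X ^ 2 : ℝ) = X ^ (2 : ℝ) by norm_cast, ← Real.rpow_add hX0]; norm_num
    calc σ₀ * η * Real.exp 3 / (3 * X * τ) * (C_W * (Real.exp 32 * Real.log z ^ 8) *
          ((6 * X ^ 3) ^ (2 / 3 : ℝ) * X ^ ((1 + τ) / 3) * D ^ (1 / 3 : ℝ) + D * X ^ (1 + τ)))
        ≤ σ₀ * η * Real.exp 3 / (3 * X * τ) * (C_W * (Real.exp 32 * L ^ 8) * (5 * X ^ (5 / 2 : ℝ))) := by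
          gcongr
      _ = (2 * σ₀ * Real.exp 35 * C_W * L ^ 9) * (5 / 6 * η * (X * Real.sqrt X) / (τ * L)) := by
          rw [hX52, show Real.exp 35 = Real.exp 3 * Real.exp 32 by rw [← Real.exp_add]; norm_num]
          have hXne : X ≠ 0 := hX0.ne'
          have hτne : τ ≠ 0 := hτ0.ne'
          have hLne : L ≠ 0 := hL0.ne'
          field_simp
          ring
      _ ≤ (τ ^ 2 * Real.sqrt X * η) * (5 / 6 * η * (X * Real.sqrt X) / (τ * L)) :=
          mul_le_mul_of_nonneg_right hkey (by positivity)
      _ = 5 / 6 * U := by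
          rw [hU, show (X ^ 2 : ℝ) = X * Real.sqrt X ^ 2 by rw [Real.sq_sqrt hX0.le]; ring]
          have hτne : τ ≠ 0 := hτ0.ne'
          have hLne : L ≠ 0 := hL0.ne'
          field_simp
      _ ≤ U := by linarith
  have hG3 : kappa σ₀ X η * (errB C_FL C_W C_B X η τ D * Real.exp W) ≤ (1 + σ₀ * Real.exp 3 * C_FL * gamma₀ * K_V + 1) * U := by
    have herrB0 : 0 ≤ errB C_FL C_W C_B X η τ D := by
      rw [errB]
      have hD0 : 0 < D := by linarith
      have : 0 ≤ Real.log (X ^ τ) := Real.log_nonneg (by linarith)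
      have := gamma₀_pos
      positivity
    calc kappa σ₀ X η * (errB C_FL C_W C_B X η τ D * Real.exp W)
        = (kappa σ₀ X η * Real.exp W) * errB C_FL C_W C_B X η τ D := by ring
      _ ≤ σ₀ * η * Real.exp 3 / (3 * X * τ) * errB C_FL C_W C_B X η τ D := mul_le_mul_of_nonneg_right hκ herrB0
      _ ≤ U + σ₀ * Real.exp 3 * C_FL * gamma₀ * K_V * U + U := by
          rw [errB, hs, mul_add, mul_add]
          exact add_le_add (add_le_add hG3a hG3b) hG3c
      _ = _ := by ring
  -- Group 4: the main terms
  have hG4a : η ^ 2 * X ^ 2 * Real.exp W * (C₇ * mertensProd z / Real.log z + σ₀ * (C₉ * mertensProd z / Real.log z)) ≤ U := by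
    rw [hlogz]
    have h1 : C₇ * mertensProd z / (τ * L) + σ₀ * (C₉ * mertensProd z / (τ * L)) ≤ (C₇ + σ₀ * C₉) * (14 / (τ * L)) / (τ * L) := by
      rw [show C₇ * mertensProd z / (τ * L) + σ₀ * (C₉ * mertensProd z / (τ * L)) = (C₇ + σ₀ * C₉) * mertensProd z / (τ * L) by ring]
      rw [mul_div_assoc, mul_div_assoc]
      exact mul_le_mul_of_nonneg_left (div_le_div_of_nonneg_right hV hτL0.le) (by positivity)
    calc η ^ 2 * X ^ 2 * Real.exp W * (C₇ * mertensProd z / (τ * L) + σ₀ * (C₉ * mertensProd z / (τ * L)))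
        ≤ η ^ 2 * X ^ 2 * (Real.exp 3 / τ) * ((C₇ + σ₀ * C₉) * (14 / (τ * L)) / (τ * L)) := by gcongr
      _ = (14 * Real.exp 3 * (C₇ + σ₀ * C₉)) / (τ ^ 4 * L) * U := by rw [hU]; field_simp
      _ ≤ 1 * U := by
          refine mul_le_mul_of_nonneg_right ?_ hU0.le
          rw [div_le_one (by positivity)]; exact hE4
      _ = U := one_mul U
  have hG4b : η ^ 2 * X ^ 2 * Real.exp W * (σ₀ * mertensProd z *
      (W * z⁻¹ + 12 / (z / 2) ^ (1 / 3 : ℝ) + 54 / (z / 2))) ≤ U := by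
    -- `W z⁻¹ + 12 (z/2)^{-1/3} + 54 (z/2)⁻¹ ≤ (1/τ + 135) z^{-1/3} ≤ 136 τ⁻¹ z^{-1/3}`
    have hz13 : 0 < z ^ (1 / 3 : ℝ) := Real.rpow_pos_of_pos hz0 _
    have hz1 : 1 ≤ z := by linarith
    have hzz : z ^ (1 / 3 : ℝ) ≤ z := by
      calc z ^ (1 / 3 : ℝ) ≤ z ^ (1 : ℝ) := Real.rpow_le_rpow_of_exponent_le hz1 (by norm_num)
        _ = z := Real.rpow_one z
    have hinvz : z⁻¹ ≤ (z ^ (1 / 3 : ℝ))⁻¹ := inv_anti₀ hz13 hzz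
    have hhalf : 12 / (z / 2) ^ (1 / 3 : ℝ) ≤ 24 * (z ^ (1 / 3 : ℝ))⁻¹ := by
      rw [Real.div_rpow hz0.le (by norm_num), div_div_eq_mul_div]
      have h2 : (2 : ℝ) ^ (1 / 3 : ℝ) ≤ 2 := by
        calc (2 : ℝ) ^ (1 / 3 : ℝ) ≤ (2 : ℝ) ^ (1 : ℝ) := Real.rpow_le_rpow_of_exponent_le (by norm_num) (by norm_num)
          _ = 2 := Real.rpow_one 2
      rw [div_eq_mul_inv]
      exact mul_le_mul_of_nonneg_right (by linarith [h2]) (inv_pos.mpr hz13).le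
    have hW0 : 0 ≤ W := smallPrimesWeight_nonneg X τ
    have hbr : W * z⁻¹ + 12 / (z / 2) ^ (1 / 3 : ℝ) + 54 / (z / 2) ≤ 136 * τ⁻¹ * (z ^ (1 / 3 : ℝ))⁻¹ := by
      have h54 : 54 / (z / 2) = 108 * z⁻¹ := by field_simp; ring
      rw [h54]
      have hτinv : 1 ≤ τ⁻¹ := one_le_inv₀ hτ0 |>.mpr hτ1
      have hWz : W * z⁻¹ ≤ (τ⁻¹ + 3) * (z ^ (1 / 3 : ℝ))⁻¹ := by
        calc W * z⁻¹ ≤ (1 / τ + 3) * z⁻¹ := mul_le_mul_of_nonneg_right hWle' (by positivity)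
          _ ≤ (τ⁻¹ + 3) * (z ^ (1 / 3 : ℝ))⁻¹ := by
              rw [one_div]; exact mul_le_mul_of_nonneg_left hinvz (by positivity)
      have h108 : 108 * z⁻¹ ≤ 108 * (z ^ (1 / 3 : ℝ))⁻¹ := mul_le_mul_of_nonneg_left hinvz (by norm_num)
      have hw0 : 0 ≤ (z ^ (1 / 3 : ℝ))⁻¹ := (inv_pos.mpr hz13).le
      have hw : (z ^ (1 / 3 : ℝ))⁻¹ ≤ τ⁻¹ * (z ^ (1 / 3 : ℝ))⁻¹ := le_mul_of_one_le_left hw0 hτinv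
      have hWz' : W * z⁻¹ ≤ τ⁻¹ * (z ^ (1 / 3 : ℝ))⁻¹ + 3 * (z ^ (1 / 3 : ℝ))⁻¹ := by linarith [hWz]
      linarith [hWz', hhalf, h108, hw]
    have hτz : 1904 * σ₀ * Real.exp 3 ≤ τ ^ 4 * z ^ (1 / 3 : ℝ) := hE5
    have hbr0 : 0 ≤ W * z⁻¹ + 12 / (z / 2) ^ (1 / 3 : ℝ) + 54 / (z / 2) := by positivity
    calc η ^ 2 * X ^ 2 * Real.exp W * (σ₀ * mertensProd z * (W * z⁻¹ + 12 / (z / 2) ^ (1 / 3 : ℝ) + 54 / (z / 2)))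
        ≤ η ^ 2 * X ^ 2 * (Real.exp 3 / τ) * (σ₀ * (14 / (τ * L)) * (136 * τ⁻¹ * (z ^ (1 / 3 : ℝ))⁻¹)) := by
          gcongr
      _ = (1904 * σ₀ * Real.exp 3) / (τ ^ 4 * z ^ (1 / 3 : ℝ)) * U := by rw [hU]; field_simp; ring
      _ ≤ 1 * U := by
          refine mul_le_mul_of_nonneg_right ?_ hU0.le
          rw [div_le_one (by positivity)]; exact hτz
      _ = U := one_mul U
  -- total
  have htotal : C_A * C_PA * Real.exp 3 * U + U + (1 + σ₀ * Real.exp 3 * C_FL * gamma₀ * K_V + 1) * U + (U + U) =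
      (C_A * C_PA * Real.exp 3 + σ₀ * Real.exp 3 * C_FL * gamma₀ * K_V + 5) * τ * η ^ 2 * X ^ 2 / L := by
    rw [hU]; ring
  rw [← htotal]
  refine hmaster.trans (add_le_add (add_le_add (add_le_add hG1 hG2) hG3) ?_)
  rw [mul_add]
  exact add_le_add hG4a hG4b


/-! ### The choice of `X₀`: the growth conditions hold for `τ = (log log X)^{-ϖ}` and large `X` -/

/-- `√(e^a) = e^{a/2}`. [folklore] -/
theorem sqrt_exp (a : ℝ) : Real.sqrt (Real.exp a) = Real.exp (a / 2) := by
  rw [show Real.exp a = Real.exp (a / 2) ^ 2 by rw [← Real.exp_nat_mul]; ring_nf, Real.sqrt_sq (Real.exp_pos _).le]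

/-- `L^{1/3} ≤ √L/8` for `L ≥ 8⁶`, and `L^{1/3} ≤ L/4` for `L ≥ 8`. [folklore] -/
theorem rpow_third_le {L : ℝ} (hL : (8 : ℝ) ^ 6 ≤ L) : L ^ (1 / 3 : ℝ) ≤ Real.sqrt L / 8 ∧ L ^ (1 / 3 : ℝ) ≤ L / 4 := by
  have hL0 : 0 < L := lt_of_lt_of_le (by norm_num) hL
  have h16 : (8 : ℝ) ≤ L ^ (1 / 6 : ℝ) := by
    calc (8 : ℝ) = ((8 : ℝ) ^ 6) ^ (1 / 6 : ℝ) := by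
          rw [show ((8 : ℝ) ^ 6) = (8 : ℝ) ^ (6 : ℝ) by norm_cast, ← Real.rpow_mul (by norm_num)]; norm_num
      _ ≤ L ^ (1 / 6 : ℝ) := Real.rpow_le_rpow (by norm_num) hL (by norm_num)
  have hsqrt : Real.sqrt L = L ^ (1 / 3 : ℝ) * L ^ (1 / 6 : ℝ) := by
    rw [Real.sqrt_eq_rpow, ← Real.rpow_add hL0]; norm_num
  have h13 : 0 < L ^ (1 / 3 : ℝ) := Real.rpow_pos_of_pos hL0 _
  constructor
  · rw [hsqrt, le_div_iff₀ (by norm_num)]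
    nlinarith [mul_le_mul_of_nonneg_left h16 h13.le]
  · -- `L = L^{1/3} · L^{2/3}` and `L^{2/3} ≥ (8^6)^{2/3} = 4^… ≥ 4`
    have h23 : (4 : ℝ) ≤ L ^ (2 / 3 : ℝ) := by
      calc (4 : ℝ) ≤ ((8 : ℝ) ^ 6) ^ (2 / 3 : ℝ) := by
            rw [show ((8 : ℝ) ^ 6) = (8 : ℝ) ^ (6 : ℝ) by norm_cast, ← Real.rpow_mul (by norm_num)]; norm_num
        _ ≤ L ^ (2 / 3 : ℝ) := Real.rpow_le_rpow (by norm_num) hL (by norm_num)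
    have hL' : L = L ^ (1 / 3 : ℝ) * L ^ (2 / 3 : ℝ) := by
      rw [← Real.rpow_add hL0]; norm_num
    rw [le_div_iff₀ (by norm_num)]
    nlinarith [mul_le_mul_of_nonneg_left h23 h13.le]

set_option maxHeartbeats 800000 in
/-- **Lemma 3.5 from the level of distribution of `𝒜` and Mertens' theorem for `K`.** If
(i) the Type I level-of-distribution bound for `𝒜` holds in the summed form produced by Lemma 3.2
(`HeathBrownCubicFLRemaindersA.level_of_typeI_A`): for some `θ < 2`,
`∑_{N(R) ≤ X^{3/2}, N(R) square-free} |#𝒜^(K)_R − (6η²X²/π²)ρ₂(R)/N(R)| ≤ C X^θ` for `X ≥ X₀` and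
`exp(−(log X)^{1/3}) ≤ η ≤ 1`; and (ii) Mertens' theorem for the prime ideals of `K = ℚ(∛2)` holds with
the residue constant `γ₀` in the form `∏_{p<z}∏_{P∣p}(1 − N(P)^{-1})·e^γγ₀ log z = 1 + O(1/log z)`
(Rosen 1999, Thm 2, grouped by rational primes); then Heath-Brown's Lemma 3.5 holds: for `0 < ϖ < 1/5`,
`τ = (log log X)^{-ϖ}`, `∑_{n ≤ n₀} |T^(n)(𝒜) − κT^(n)(ℬ)| ≪ τη²X²/log X`. The proof is §6 of the paper as
rendered in `HeathBrownCubicFLSequencesA/B`, `…RemaindersA`, `…Chains`, `…Products` and this file, with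
level `D = X^{1/4}` on both sides and `X₀` chosen so that the growth conditions of
`lemma_3_5_bound_of_params` hold. [cite: HeathBrownActa2001, Lemma 3.5 and §6] -/
theorem HeathBrown2001_lemma_3_5_of
    (hlev : ∃ θ : ℝ, θ < 2 ∧ ∃ C X₀ : ℝ, ∀ X η : ℝ, X₀ ≤ X → Real.exp (-Real.log X ^ (1 / 3 : ℝ)) ≤ η → η ≤ 1 →
      ∑ R ∈ (idealsLE ⌊X ^ (3 / 2 : ℝ)⌋₊).filter (fun R => Squarefree (Ideal.absNorm R)),
        |(countA X η R : ℝ) - sizeA X η * rho₂ R / Ideal.absNorm R| ≤ C * X ^ θ)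
    (hmer : ∃ C z₀ : ℝ, ∀ z : ℝ, z₀ ≤ z →
      |(∏ p ∈ Nat.primesBelow ⌈z⌉₊, (1 - normDensityAt p)) *
          (Real.exp Real.eulerMascheroniConstant * gamma₀ * Real.log z) - 1| ≤ C / Real.log z) :
    HeathBrown2001_lemma_3_5 := by
  intro σ₀ hσ ϖ hϖ0 hϖ5
  have hϖ1 : ϖ ≤ 1 := by linarith
  -- the constants
  obtain ⟨hσ₀, C₇, z₇, hC7, h7⟩ := exists_abs_prodA_sub_le hσ
  obtain ⟨C₉, z₉, hC9, h9⟩ := exists_abs_prodB_sub_le_of hmer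
  obtain ⟨C_A, hCA, hFLA⟩ := exists_FLBound dimConst
  obtain ⟨C_FL, hCFL, hFLB⟩ := exists_FLBound (Real.exp (3 * (9 / 2 + 6 / Real.log 2) + 3))
  obtain ⟨C_W, hCW, hW⟩ := exists_windowDvdCount_sub_le
  obtain ⟨C_B, hCB, hB⟩ := exists_countB_le
  obtain ⟨C₁, hC1, hW1⟩ := exists_smallPrimesWeight_le
  obtain ⟨C_PA, z_PA, hCPA, hPA⟩ := exists_prodA_le hσ
  obtain ⟨K_V, hKV0, hKV⟩ := exists_prod_one_sub_normDensityAt_le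
  obtain ⟨θ, hθ, C_L, X_L, hL⟩ := hlev
  set δ := 2 - θ with hδ
  have hδ0 : 0 < δ := by rw [hδ]; linarith
  set C_L' := max C_L 1 with hCL'
  have hCL'1 : 1 ≤ C_L' := le_max_right _ _
  have hCL'0 : 0 < C_L' := by linarith
  -- thresholds on `L = log X`
  set A₄ := 14 * Real.exp 3 * (C₇ + σ₀ * C₉) with hA₄
  set A₅ := 1904 * σ₀ * Real.exp 3 with hA₅
  set A₆ := 3 * σ₀ * Real.exp 3 * C_B with hA₆
  set A₇ := 2 * σ₀ * Real.exp 35 * C_W with hA₇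
  have hA₄0 : 0 ≤ A₄ := by positivity
  have hA₅0 : 0 ≤ A₅ := by positivity
  have hA₆0 : 0 ≤ A₆ := by positivity
  have hA₇0 : 0 ≤ A₇ := by positivity
  set ℓ₀ := max 1 (max ((1 / 4 : ℝ) ^ (-(1 / ϖ))) ((((4 : ℝ) ^ 6 * 720)⁻¹) ^ (-(1 / ϖ)))) with hℓ₀
  set T₁ := max ((2 : ℝ) ^ 10) (max z₇ (max z₉ (max z_PA (2 * C₁)))) with hT₁
  have hT₁0 : 0 ≤ T₁ := le_trans (by norm_num) (le_max_left _ _)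
  set L₀ := max (Real.exp ℓ₀) (max (4 * T₁ ^ 2) (max ((4096 * A₄) ^ 2) (max (36 * (2 * (24576 * A₅)) ^ 2)
    (max (64 * (120 * (16384 * A₆)) ^ 2) (max ((8 : ℝ) ^ 6) (max (4 * ((Nat.factorial 11 : ℝ) * (4 ^ 11 * A₇)))
    (max ((4 / δ) ^ (3 / 2 : ℝ)) (2 * (6 * (8 * C_L' / δ ^ 2)) / δ)))))))) with hL₀
  refine ⟨C_A * C_PA * Real.exp 3 + σ₀ * Real.exp 3 * C_FL * gamma₀ * K_V + 5, max X_L (Real.exp L₀),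
    fun X η hX hηlo hη1 => ?_⟩
  -- unpack the thresholds
  have hXL : X_L ≤ X := le_trans (le_max_left _ _) hX
  have hXe : Real.exp L₀ ≤ X := le_trans (le_max_right _ _) hX
  set L := Real.log X with hLdef
  have hLL₀ : L₀ ≤ L := le_log_of_exp_le hXe
  have hL_ℓ₀ : Real.exp ℓ₀ ≤ L := le_trans (le_max_left _ _) hLL₀
  have hL_T₁ : 4 * T₁ ^ 2 ≤ L := le_trans (le_trans (le_max_left _ _) (le_max_right _ _)) hLL₀
  have hL_A₄ : (4096 * A₄) ^ 2 ≤ L :=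
    le_trans (le_trans (le_trans (le_max_left _ _) (le_max_right _ _)) (le_max_right _ _)) hLL₀
  have hL_A₅ : 36 * (2 * (24576 * A₅)) ^ 2 ≤ L :=
    le_trans (le_trans (le_trans (le_trans (le_max_left _ _) (le_max_right _ _)) (le_max_right _ _)) (le_max_right _ _)) hLL₀
  have hL_A₆ : 64 * (120 * (16384 * A₆)) ^ 2 ≤ L :=
    le_trans (le_trans (le_trans (le_trans (le_trans (le_max_left _ _) (le_max_right _ _)) (le_max_right _ _))
      (le_max_right _ _)) (le_max_right _ _)) hLL₀
  have hL_86 : (8 : ℝ) ^ 6 ≤ L :=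
    le_trans (le_trans (le_trans (le_trans (le_trans (le_trans (le_max_left _ _) (le_max_right _ _)) (le_max_right _ _))
      (le_max_right _ _)) (le_max_right _ _)) (le_max_right _ _)) hLL₀
  have hL_A₇ : 4 * ((Nat.factorial 11 : ℝ) * (4 ^ 11 * A₇)) ≤ L :=
    le_trans (le_trans (le_trans (le_trans (le_trans (le_trans (le_trans (le_max_left _ _) (le_max_right _ _))
      (le_max_right _ _)) (le_max_right _ _)) (le_max_right _ _)) (le_max_right _ _)) (le_max_right _ _)) hLL₀
  have hL_δ : (4 / δ) ^ (3 / 2 : ℝ) ≤ L :=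
    le_trans (le_trans (le_trans (le_trans (le_trans (le_trans (le_trans (le_trans (le_max_left _ _) (le_max_right _ _))
      (le_max_right _ _)) (le_max_right _ _)) (le_max_right _ _)) (le_max_right _ _)) (le_max_right _ _))
      (le_max_right _ _)) hLL₀
  have hL_CL : 2 * (6 * (8 * C_L' / δ ^ 2)) / δ ≤ L :=
    le_trans (le_trans (le_trans (le_trans (le_trans (le_trans (le_trans (le_trans (le_max_right _ _) (le_max_right _ _))
      (le_max_right _ _)) (le_max_right _ _)) (le_max_right _ _)) (le_max_right _ _)) (le_max_right _ _))
      (le_max_right _ _)) hLL₀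
  -- basic sizes
  have hL86 : (262144 : ℝ) ≤ L := by norm_num at hL_86; exact hL_86
  have hL1 : 1 ≤ L := by linarith
  have hL0 : 0 < L := by linarith
  have hX0 : 0 < X := lt_of_lt_of_le (Real.exp_pos _) hXe
  have hXexp : X = Real.exp L := by rw [hLdef, Real.exp_log hX0]
  have hX3 : 3 ≤ X := by
    rw [hXexp]
    have := Real.add_one_le_exp L
    linarith
  set ℓ := Real.log L with hℓdef
  have hℓ_ℓ₀ : ℓ₀ ≤ ℓ := le_log_of_exp_le hL_ℓ₀
  have hℓ1 : 1 ≤ ℓ := le_trans (le_max_left _ _) hℓ_ℓ₀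
  have hℓ0 : 0 < ℓ := by linarith
  have hτdef : hbTau ϖ X = ℓ ^ (-ϖ) := rfl
  set τ := hbTau ϖ X with hτ
  obtain ⟨hτ0, hτ1, hℓτ⟩ := hbTau_bounds (X := X) hϖ0 hϖ1 hℓ1
  rw [← hτ] at hτ0 hτ1 hℓτ
  have hτ4 : τ ≤ 1 / 4 := by
    rw [hτ]; exact hbTau_le_of hϖ0 (by norm_num) (le_trans (le_trans (le_max_left _ _) (le_max_right _ _)) hℓ_ℓ₀)
  have hτsmall : τ ≤ ((4 : ℝ) ^ 6 * 720)⁻¹ := by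
    rw [hτ]; exact hbTau_le_of hϖ0 (by norm_num) (le_trans (le_trans (le_max_right _ _) (le_max_right _ _)) hℓ_ℓ₀)
  have hτinv : τ⁻¹ ≤ ℓ := by
    have := inv_anti₀ (inv_pos.mpr hℓ0) hℓτ
    rwa [inv_inv] at this
  obtain ⟨hℓsqrt, hℓ8⟩ := log_le_sqrt_and hL0.le
  rw [← hℓdef] at hℓsqrt hℓ8
  have hsqrtL0 : 0 < Real.sqrt L := Real.sqrt_pos.mpr hL0
  have hsqL : Real.sqrt L * Real.sqrt L = L := Real.mul_self_sqrt hL0.le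
  -- `τ L ≥ √L/2`
  have hτL : Real.sqrt L / 2 ≤ τ * L := by
    have h1 : L / ℓ ≤ τ * L := by
      rw [div_le_iff₀ hℓ0]
      calc L = ℓ⁻¹ * (L * ℓ) := by field_simp
        _ ≤ τ * (L * ℓ) := mul_le_mul_of_nonneg_right hℓτ (by positivity)
        _ = τ * L * ℓ := by ring
    have h2 : Real.sqrt L / 2 ≤ L / ℓ := by
      rw [div_le_div_iff₀ (by norm_num) hℓ0]
      calc Real.sqrt L * ℓ ≤ Real.sqrt L * (2 * Real.sqrt L) := mul_le_mul_of_nonneg_left hℓsqrt hsqrtL0.le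
        _ = L * 2 := by rw [mul_left_comm, hsqL, mul_comm]
    linarith only [h1, h2]
  have hT₁L : T₁ ≤ Real.sqrt L / 2 := by
    have : Real.sqrt (4 * T₁ ^ 2) ≤ Real.sqrt L := Real.sqrt_le_sqrt hL_T₁
    rw [show (4 : ℝ) * T₁ ^ 2 = (2 * T₁) ^ 2 by ring, Real.sqrt_sq (by positivity)] at this
    linarith
  -- `z = X^τ = e^{τL}`
  have hzexp : X ^ τ = Real.exp (τ * L) := by rw [Real.rpow_def_of_pos hX0, ← hLdef, mul_comm]
  have hzge : Real.sqrt L / 2 ≤ X ^ τ := by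
    rw [hzexp]; linarith [Real.add_one_le_exp (τ * L)]
  have hz10 : (2 : ℝ) ^ 10 ≤ X ^ τ := le_trans (le_trans (le_max_left _ _) hT₁L) hzge
  have hz7 : z₇ ≤ X ^ τ := le_trans (le_trans (le_trans (le_max_left _ _) (le_max_right _ _)) hT₁L) hzge
  have hz9 : z₉ ≤ X ^ τ :=
    le_trans (le_trans (le_trans (le_trans (le_max_left _ _) (le_max_right _ _)) (le_max_right _ _)) hT₁L) hzge
  have hzPA : z_PA ≤ X ^ τ :=
    le_trans (le_trans (le_trans (le_trans (le_trans (le_max_left _ _) (le_max_right _ _)) (le_max_right _ _))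
      (le_max_right _ _)) hT₁L) hzge
  have hC1' : 2 * C₁ ≤ τ * L :=
    le_trans (le_trans (le_trans (le_trans (le_trans (le_max_right _ _) (le_max_right _ _)) (le_max_right _ _))
      (le_max_right _ _)) hT₁L) hτL
  have hz16 : (16 : ℝ) ≤ X ^ τ := le_trans (by norm_num) hz10
  -- (E3)
  have hE3 : Real.exp (-(1 / (4 * τ))) ≤ τ ^ 5 := by
    refine exp_neg_inv_le_pow_five hτ0 ?_
    have := inv_anti₀ hτ0 hτsmall
    rwa [inv_inv] at this
  -- `τ⁻⁴ ≤ ℓ⁴ ≤ 4096 √L` and `τ⁻² ≤ ℓ² ≤ 4L`, `τ⁻¹ ≤ 2L`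
  have hℓ4 : ℓ ^ 4 ≤ 4096 * Real.sqrt L := by
    have h1 : ℓ ^ 4 ≤ (8 * L ^ (1 / 8 : ℝ)) ^ 4 := pow_le_pow_left₀ hℓ0.le hℓ8 4
    have h2 : (L ^ (1 / 8 : ℝ)) ^ 4 = Real.sqrt L := by
      rw [← Real.rpow_natCast, ← Real.rpow_mul hL0.le, Real.sqrt_eq_rpow]; norm_num
    calc ℓ ^ 4 ≤ (8 * L ^ (1 / 8 : ℝ)) ^ 4 := h1
      _ = 4096 * Real.sqrt L := by rw [mul_pow, h2]; norm_num
  have hτ4inv : 1 ≤ τ ^ 4 * ℓ ^ 4 := by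
    have h := pow_le_pow_left₀ (inv_pos.mpr hℓ0).le hℓτ 4
    rw [inv_pow] at h
    have := mul_le_mul_of_nonneg_right h (pow_nonneg hℓ0.le 4)
    rwa [inv_mul_cancel₀ (pow_ne_zero 4 hℓ0.ne')] at this
  have hτ2inv : 1 ≤ τ ^ 2 * ℓ ^ 2 := by
    have h := pow_le_pow_left₀ (inv_pos.mpr hℓ0).le hℓτ 2
    rw [inv_pow] at h
    have := mul_le_mul_of_nonneg_right h (pow_nonneg hℓ0.le 2)
    rwa [inv_mul_cancel₀ (pow_ne_zero 2 hℓ0.ne')] at this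
  have hℓ2 : ℓ ^ 2 ≤ 4 * L := by
    calc ℓ ^ 2 ≤ (2 * Real.sqrt L) ^ 2 := pow_le_pow_left₀ hℓ0.le hℓsqrt 2
      _ = 4 * L := by rw [mul_pow, Real.sq_sqrt hL0.le]; norm_num
  have hsqrtLL : Real.sqrt L ≤ L := Real.sqrt_le_iff.mpr ⟨hL0.le, by nlinarith only [hL1]⟩
  have hℓL : ℓ ≤ 2 * L := by linarith only [hℓsqrt, hsqrtLL]
  -- (E4): `A₄ ≤ τ⁴ L`
  have hE4 : A₄ ≤ τ ^ 4 * L := by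
    have hsq : 4096 * A₄ ≤ Real.sqrt L := by
      have := Real.sqrt_le_sqrt hL_A₄
      rwa [Real.sqrt_sq (by positivity)] at this
    -- `τ⁴ L ≥ L/ℓ⁴ ≥ L/(4096√L) = √L/4096 ≥ A₄`
    have h2 : 1 ≤ τ ^ 4 * (4096 * Real.sqrt L) :=
      hτ4inv.trans (mul_le_mul_of_nonneg_left hℓ4 (pow_nonneg hτ0.le 4))
    have h1 : Real.sqrt L ≤ 4096 * (τ ^ 4 * L) := by
      calc Real.sqrt L = 1 * Real.sqrt L := (one_mul _).symm
        _ ≤ τ ^ 4 * (4096 * Real.sqrt L) * Real.sqrt L := mul_le_mul_of_nonneg_right h2 hsqrtL0.le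
        _ = 4096 * (τ ^ 4 * L) := by
            rw [show τ ^ 4 * (4096 * Real.sqrt L) * Real.sqrt L = 4096 * τ ^ 4 * (Real.sqrt L * Real.sqrt L) by ring,
              hsqL]; ring
    linarith only [hsq, h1]
  -- (E5): `A₅ ≤ τ⁴ z^{1/3}`
  have hE5 : A₅ ≤ τ ^ 4 * (X ^ τ) ^ (1 / 3 : ℝ) := by
    have hz13 : (X ^ τ) ^ (1 / 3 : ℝ) = Real.exp (τ * L / 3) := by
      rw [hzexp, ← Real.exp_mul]; ring_nf
    rw [hz13]
    set y := Real.sqrt L / 6 with hy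
    have hy0 : 0 ≤ y := by positivity
    have hyexp : Real.exp y ≤ Real.exp (τ * L / 3) := Real.exp_le_exp.mpr (by rw [hy]; linarith)
    have hyA : ((1 + 1).factorial : ℝ) * (24576 * A₅) ≤ y := by
      rw [hy, le_div_iff₀ (by norm_num)]
      have := Real.sqrt_le_sqrt hL_A₅
      rw [show (36 : ℝ) * (2 * (24576 * A₅)) ^ 2 = (6 * (2 * (24576 * A₅))) ^ 2 by ring,
        Real.sqrt_sq (by positivity)] at this
      norm_num [Nat.factorial]
      linarith
    have hkey := mul_pow_le_exp_of_le hy0 hyA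
    rw [pow_one] at hkey
    -- `A₅ · 4096√L = 24576 A₅ y ≤ e^y ≤ e^{τL/3}` and `1 ≤ τ⁴ ℓ⁴ ≤ τ⁴ 4096 √L`
    have h1 : A₅ * (4096 * Real.sqrt L) ≤ Real.exp (τ * L / 3) := by
      rw [show A₅ * (4096 * Real.sqrt L) = 24576 * A₅ * y by rw [hy]; ring]; exact hkey.trans hyexp
    have h2 : 1 ≤ τ ^ 4 * (4096 * Real.sqrt L) :=
      hτ4inv.trans (mul_le_mul_of_nonneg_left hℓ4 (pow_nonneg hτ0.le 4))
    calc A₅ = A₅ * 1 := (mul_one _).symm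
      _ ≤ A₅ * (τ ^ 4 * (4096 * Real.sqrt L)) := mul_le_mul_of_nonneg_left h2 hA₅0
      _ = τ ^ 4 * (A₅ * (4096 * Real.sqrt L)) := by ring
      _ ≤ τ ^ 4 * Real.exp (τ * L / 3) := mul_le_mul_of_nonneg_left h1 (pow_nonneg hτ0.le 4)
  -- (E6): `A₆ L ≤ τ² √z e^{-L^{1/3}}`
  obtain ⟨h13a, h13b⟩ := rpow_third_le hL_86
  have hE6 : A₆ * L ≤ τ ^ 2 * Real.sqrt (X ^ τ) * Real.exp (-L ^ (1 / 3 : ℝ)) := by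
    have hsz : Real.sqrt (X ^ τ) = Real.exp (τ * L / 2) := by rw [hzexp, sqrt_exp]
    rw [hsz]
    set y := Real.sqrt L / 8 with hy
    have hy0 : 0 ≤ y := by positivity
    -- `e^{τL/2 − L^{1/3}} ≥ e^{√L/4 − √L/8} = e^{y}`
    have hexp : Real.exp y ≤ Real.exp (τ * L / 2) * Real.exp (-L ^ (1 / 3 : ℝ)) := by
      rw [← Real.exp_add]; refine Real.exp_le_exp.mpr ?_; rw [hy]; linarith
    have hyA : ((4 + 1).factorial : ℝ) * (16384 * A₆) ≤ y := by
      rw [hy, le_div_iff₀ (by norm_num)]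
      have := Real.sqrt_le_sqrt hL_A₆
      rw [show (64 : ℝ) * (120 * (16384 * A₆)) ^ 2 = (8 * (120 * (16384 * A₆))) ^ 2 by ring,
        Real.sqrt_sq (by positivity)] at this
      norm_num [Nat.factorial]
      linarith
    have hkey := mul_pow_le_exp_of_le hy0 hyA
    -- `4 A₆ L² = 16384 A₆ y⁴ ≤ e^y` (`L = 64 y²`)
    have hLy : L = 64 * y ^ 2 := by rw [hy, div_pow, Real.sq_sqrt hL0.le]; ring
    have h1 : 4 * A₆ * L ^ 2 ≤ Real.exp (τ * L / 2) * Real.exp (-L ^ (1 / 3 : ℝ)) := by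
      calc 4 * A₆ * L ^ 2 = 16384 * A₆ * y ^ 4 := by rw [hLy]; ring
        _ ≤ Real.exp y := hkey
        _ ≤ _ := hexp
    -- `1 ≤ τ² ℓ² ≤ 4 τ² L`
    have h2 : 1 ≤ 4 * τ ^ 2 * L := by
      calc (1 : ℝ) ≤ τ ^ 2 * ℓ ^ 2 := hτ2inv
        _ ≤ τ ^ 2 * (4 * L) := mul_le_mul_of_nonneg_left hℓ2 (pow_nonneg hτ0.le 2)
        _ = 4 * τ ^ 2 * L := by ring
    calc A₆ * L = A₆ * L * 1 := (mul_one _).symm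
      _ ≤ A₆ * L * (4 * τ ^ 2 * L) := mul_le_mul_of_nonneg_left h2 (by positivity)
      _ = τ ^ 2 * (4 * A₆ * L ^ 2) := by ring
      _ ≤ τ ^ 2 * (Real.exp (τ * L / 2) * Real.exp (-L ^ (1 / 3 : ℝ))) := mul_le_mul_of_nonneg_left h1 (pow_nonneg hτ0.le 2)
      _ = _ := by ring
  -- (E7): `A₇ L⁹ ≤ τ² √X e^{-L^{1/3}}`
  have hE7 : A₇ * L ^ 9 ≤ τ ^ 2 * Real.sqrt X * Real.exp (-L ^ (1 / 3 : ℝ)) := by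
    have hsX : Real.sqrt X = Real.exp (L / 2) := by rw [hXexp, sqrt_exp]
    rw [hsX]
    set y := L / 4 with hy
    have hy0 : 0 ≤ y := by positivity
    have hexp : Real.exp y ≤ Real.exp (L / 2) * Real.exp (-L ^ (1 / 3 : ℝ)) := by
      rw [← Real.exp_add]; refine Real.exp_le_exp.mpr ?_; rw [hy]; linarith
    have hyA : ((10 + 1).factorial : ℝ) * (4 ^ 11 * A₇) ≤ y := by
      rw [hy, le_div_iff₀ (by norm_num)]
      linarith
    have hkey := mul_pow_le_exp_of_le hy0 hyA
    have h1 : 4 * A₇ * L ^ 10 ≤ Real.exp (L / 2) * Real.exp (-L ^ (1 / 3 : ℝ)) := by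
      calc 4 * A₇ * L ^ 10 = 4 ^ 11 * A₇ * y ^ 10 := by rw [hy]; ring
        _ ≤ Real.exp y := hkey
        _ ≤ _ := hexp
    have h2 : 1 ≤ 4 * τ ^ 2 * L := by
      calc (1 : ℝ) ≤ τ ^ 2 * ℓ ^ 2 := hτ2inv
        _ ≤ τ ^ 2 * (4 * L) := mul_le_mul_of_nonneg_left hℓ2 (pow_nonneg hτ0.le 2)
        _ = 4 * τ ^ 2 * L := by ring
    calc A₇ * L ^ 9 = A₇ * L ^ 9 * 1 := (mul_one _).symm
      _ ≤ A₇ * L ^ 9 * (4 * τ ^ 2 * L) := mul_le_mul_of_nonneg_left h2 (by positivity)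
      _ = τ ^ 2 * (4 * A₇ * L ^ 10) := by ring
      _ ≤ τ ^ 2 * (Real.exp (L / 2) * Real.exp (-L ^ (1 / 3 : ℝ))) := mul_le_mul_of_nonneg_left h1 (pow_nonneg hτ0.le 2)
      _ = _ := by ring
  -- (E8): `C_L L e^{2L^{1/3}} X^θ ≤ τ X²`
  have hE8 : C_L * L * Real.exp (2 * L ^ (1 / 3 : ℝ)) * X ^ θ ≤ τ * X ^ 2 := by
    have hXθ : X ^ θ = Real.exp (θ * L) := by rw [Real.rpow_def_of_pos hX0, ← hLdef, mul_comm]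
    have hX2 : X ^ 2 = Real.exp (2 * L) := by rw [hXexp, ← Real.exp_nat_mul]; norm_num
    rw [hXθ, hX2]
    -- `2L^{1/3} ≤ δL/2`
    have h13δ : 2 * L ^ (1 / 3 : ℝ) ≤ δ * L / 2 := by
      have h23 : 4 / δ ≤ L ^ (2 / 3 : ℝ) := by
        calc 4 / δ = ((4 / δ) ^ (3 / 2 : ℝ)) ^ (2 / 3 : ℝ) := by
              rw [← Real.rpow_mul (by positivity)]; norm_num
          _ ≤ L ^ (2 / 3 : ℝ) := Real.rpow_le_rpow (by positivity) hL_δ (by norm_num)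
      have hL' : L = L ^ (1 / 3 : ℝ) * L ^ (2 / 3 : ℝ) := by rw [← Real.rpow_add hL0]; norm_num
      have h13 : 0 < L ^ (1 / 3 : ℝ) := Real.rpow_pos_of_pos hL0 _
      have : 4 / δ * L ^ (1 / 3 : ℝ) ≤ L := by
        calc 4 / δ * L ^ (1 / 3 : ℝ) ≤ L ^ (2 / 3 : ℝ) * L ^ (1 / 3 : ℝ) := mul_le_mul_of_nonneg_right h23 h13.le
          _ = L := by rw [mul_comm, ← hL']
      rw [div_mul_eq_mul_div, div_le_iff₀ hδ0] at this
      linarith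
    set y := δ * L / 2 with hy
    have hy0 : 0 ≤ y := by positivity
    have hyA : ((2 + 1).factorial : ℝ) * (8 * C_L' / δ ^ 2) ≤ y := by
      rw [hy, le_div_iff₀ (by norm_num)]
      rw [div_le_iff₀ hδ0] at hL_CL
      norm_num [Nat.factorial]
      linarith only [hL_CL]
    have hkey := mul_pow_le_exp_of_le hy0 hyA
    -- `2 C_L' L² = (8C_L'/δ²) y² ≤ e^y`
    have h1 : 2 * C_L' * L ^ 2 ≤ Real.exp y := by
      calc 2 * C_L' * L ^ 2 = 8 * C_L' / δ ^ 2 * y ^ 2 := by rw [hy]; field_simp; ring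
        _ ≤ Real.exp y := hkey
    -- assemble: `C_L L e^{2L^{1/3}} e^{θL} ≤ C_L' L e^{y} e^{θL}` and `τ e^{2L} ≥ e^{2L}/(2L)`
    have hCL : C_L ≤ C_L' := le_max_left _ _
    have hτℓ : 1 ≤ τ * ℓ := by
      have := mul_le_mul_of_nonneg_left hℓτ hℓ0.le
      rw [mul_inv_cancel₀ hℓ0.ne'] at this
      linarith only [this]
    have hτL2 : 1 ≤ 2 * τ * L := by
      calc (1 : ℝ) ≤ τ * ℓ := hτℓ
        _ ≤ τ * (2 * L) := mul_le_mul_of_nonneg_left hℓL hτ0.le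
        _ = 2 * τ * L := by ring
    have hexp2 : Real.exp (2 * L) = Real.exp y * Real.exp y * Real.exp (θ * L) := by
      rw [← Real.exp_add, ← Real.exp_add]; congr 1; rw [hy, hδ]; ring
    have hEθ : 0 < Real.exp (θ * L) := Real.exp_pos _
    have hEy : 0 < Real.exp y := Real.exp_pos _
    calc C_L * L * Real.exp (2 * L ^ (1 / 3 : ℝ)) * Real.exp (θ * L)
        ≤ C_L' * L * Real.exp y * Real.exp (θ * L) := by
          have : Real.exp (2 * L ^ (1 / 3 : ℝ)) ≤ Real.exp y := Real.exp_le_exp.mpr h13δ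
          gcongr
      _ = (C_L' * L) * (Real.exp y * Real.exp (θ * L)) := by ring
      _ ≤ (τ * Real.exp y) * (Real.exp y * Real.exp (θ * L)) := by
          refine mul_le_mul_of_nonneg_right ?_ (by positivity)
          -- `C_L' L ≤ τ e^y` from `2C_L'L² ≤ e^y` and `1 ≤ 2τL`
          calc C_L' * L = C_L' * L * 1 := (mul_one _).symm
            _ ≤ C_L' * L * (2 * τ * L) := mul_le_mul_of_nonneg_left hτL2 (by positivity)
            _ = τ * (2 * C_L' * L ^ 2) := by ring
            _ ≤ τ * Real.exp y := mul_le_mul_of_nonneg_left h1 hτ0.le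
      _ = τ * Real.exp (2 * L) := by rw [hexp2]; ring
  -- conclude
  have hLEV := hL X η hXL hηlo hη1
  exact lemma_3_5_bound_of_params hσ₀ hFLA hCA.le hFLB hCFL.le hasSieveDimension_normDensity hW hCW hB hCB.le hC7 h7 hC9 h9
    hCPA hPA (fun z hz => hKV z hz) hW1 hLEV hX3 hτ0 hτ4 hηlo hη1 hz16 hz7 hz9 hzPA hz10 hC1' hE3 hE4 hE5 hE6 hE7 hE8 _

/-- **Lemma 3.5 from Lemma 3.2 (`HeathBrown2001_typeI_A`) and Mertens' theorem for `K`.**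
[cite: HeathBrownActa2001, Lemmas 3.2 and 3.5] -/
theorem HeathBrown2001_lemma_3_5_of_typeI_A (hA : HeathBrown2001_typeI_A)
    (hmer : ∃ C z₀ : ℝ, ∀ z : ℝ, z₀ ≤ z →
      |(∏ p ∈ Nat.primesBelow ⌈z⌉₊, (1 - normDensityAt p)) *
          (Real.exp Real.eulerMascheroniConstant * gamma₀ * Real.log z) - 1| ≤ C / Real.log z) :
    HeathBrown2001_lemma_3_5 := by
  obtain ⟨θ, hθ, C, X₀, h⟩ := level_of_typeI_A hA
  exact HeathBrown2001_lemma_3_5_of ⟨θ, hθ, C, X₀, h⟩ hmer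

end Literature.NumberTheory.Sieve.CubicSieve

end
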